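import Mathlib.Analysis.Calculus.ContDiff.Operations
import Summits.QuantumFields.YangMills.Theorems.UnitScaleTiltProp8FlatPlaqPairs
import Summits.QuantumFields.YangMills.Theorems.UnitScaleTiltProp8FlatPlaqIncidence
import Literature.MathematicalPhysics.QuantumFieldTheory.Balaban1983to89.T3ContinuumYM3Torus
import Summits.QuantumFields.YangMills.Theorems.BalabanUVNodesN09OneDefectAveraging
import HarnessLib

/-!
# Route `UnitScaleTilt`, crux K1 child «MinimiserStabilityRegPr» (stmt-QuantumFields-19200), leaf V2′ `stub_halvingStep` — pillar P3b
# ([Balaban1985Variational] PROP. 4 AT BACKGROUND 1), PART 4a: **THE NON-QUADRATIC ACTION `𝒱_η` ON THE SETUP TORUS — SMOOTHNESS, THE LINE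
# DERIVATIVE AS A SUM OVER PLAQUETTES, THE PER-BOND PAIRING, AND THE TWO LATTICE PAIR BOUNDS `≤ 725η⁴r²`** (PART 4b = `…FlatProp4Background1`
# assembles the gradient `W₀ = (δ/δA′)V₀` and the estimate (98) from these)

Cell `ym3-torus` (HUMAN RULING D-0037, YM ladder rung R3), width seat `ym-ust-19200-w5` gen 0 (OWNER ym3-torus-plan g24, W-SEAT MAP pass #2 2026-08-28:
«w5 = `stub_halvingStep` sub-lemma P3b = [Balaban1985Variational] Prop. 4 (98) pp. 292–293 at background 1 = the displayed `hWq`∕`hWd` of F4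
`FlatSmallSolution158.existsUnique_smallSolution158_T3` … target `Theorems/UnitScaleTiltProp8FlatProp4Background1.lean`»).  `--supports stmt-QuantumFields-19200
--as helper`; count-neutral.  YM₃ on T³ is a ladder rung (R3), not the Clay problem; nothing here is a claim about the crux, d = 4 or the mass gap.

THE PRINT ([Balaban1985Variational] = T. Bałaban, CMP **102** (1985) 277–309).  (5) p. 278: «A(U) = A^η(U) = Σ_{p⊂Ω₀} η^{d−4}[1 − Re tr U(∂p)], η = L^{−k}»;
(26)–(27) p. 282: «A(U₁U₀) = A(U₀) + ⟨A,J⟩ + ½⟨A,ΔA⟩ + V₀(A)», `⟨A,J⟩ = Σ_p η^{d−2} Im tr(…)` (so the pairing is `⟨X,Y⟩ = η^d Σ_b tr(X(b)Y(b))`); Prop. 4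
pp. 292–293: «The functional derivative of V(A′) is an analytic function on this space, and satisfies the estimate |(δ/δA′)V(A′)| ≤ C₄ε₃²(Lʲη)^{−3} on Ω_j (97).
The constants a₃, C₄ depend on d and L only. … |(δ/δA′)V(A′)|₍₋₃₎ ≤ C₄(max{|A′|₍₋₁₎, |∇A′|₍₋₂₎})² (98)»; the cubic term needs (93)–(96) («we can use the
factor η to replace this derivative by a simple difference operation … can be estimated by O(1)|∇A′||A′|»); Sect. F p. 302 uses all of this at background 1.

THE OBJECTS (tree normalisation; `η` a real parameter, at the carrier `η = L^{−(K−n)}`).  For a `𝔤ᶜ = M₂(ℂ)`-valued bond field `A` on `PBond P j` and a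
plaquette `p` with edges `b₁ = ⟨x,μ⟩, b₂ = ⟨x+e_μ,ν⟩, b₃ = ⟨x+e_ν,μ⟩, b₄ = ⟨x,ν⟩` (`GaugeField.plaqHol`'s convention) put `Y₁ = iηA(b₁)`, `Y₂ = iηA(b₂)`,
`Y₃ = −iηA(b₃)`, `Y₄ = −iηA(b₄)` and `𝔣_p(A) = 1 − ½tr(e^{Y₁}e^{Y₂}e^{Y₃}e^{Y₄}) + ½tr(ΣYᵢ) + ¼tr((ΣYᵢ)²)` (the plaquette term of `wilsonAction4` of
`e^{iηA}` on `SU(2)`, holomorphically continued, MINUS its linear and quadratic Taylor parts; the linear parts sum to zero over the torus,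
`FlatPlaqIncidence.sum_plaq_curl_eq_zero`).  `𝒱_η(A) := Σ_p 𝔣_p(A)` is print's `η^{4−d}·V₀`.  The gradient in print's pairing is
`W(A)(b) = η^{−d}·∂𝒱^{print}/∂A(b) = η^{−4}·(trace-dual of ∂𝒱_η/∂A(b))`; THIS is the `W` below.
WHAT IS PROVED HERE (sorry-free; no definition; axioms standard):
* §1 `unshift_ne_self` (with the tree's `N09OneDefectAveraging.shift_ne_self`: the tori have ≥ 2 sites per direction), `edges_pairwise_ne`;
* §2 **`contDiff_V`**, `differentiable_V` — `𝒱_η(A) := Σ_p 𝔣_p(A)` is `C²` in `A` (exp is analytic);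
* §3 `V_line`, **`fderiv_V_eq_sum`** — `D𝒱_η(A)[δ] = Σ_p d/dt 𝔣(slots_p(A) + t·slots_p(δ))|₀` (chain rule + sum rule);
* §4 `deriv_line_single_eq_zero` (support), **`sum_deriv_line_single_eq_pairs`** — for `δ = 1_b·E` the sum over plaquettes is the sum over transverse
  directions `ν` of the (±) PAIRS of `FlatPlaqIncidence.sum_plaq_slots_eq_pairs`;
* §5 `pair_arith`, **`norm_pair13_le`**, **`norm_pair42_le`** — each pair contributes `≤ 725η⁴r²` on the (115)-ball (`‖A(b)‖ ≤ r`, `η⁻¹‖A(⟨s+e_ν,μ⟩) − A(⟨s,μ⟩)‖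
  ≤ r`, `0 < r ≤ ½`, `0 < η ≤ 1`, `‖E‖ ≤ 1`): PART 3b's pair lemmas with `m = ηr`, `Δ = δ = η²r`, `ρ = r`, `‖H‖ = η‖E‖ ≤ η`.
HONEST SCOPE.  (i) This is the PURE-ACTION part `V₀` of Prop. 4 at background 1 ((90)–(96)); the chart-dressing terms (84)–(89) (the operators `H`, `D(A′)`,
`δD/δA′`, `(QGQ*)⁻¹` of Sect. C — pillar P2's letters) are an abstract composition on top and are NOT here; (ii) the normalisation is print's (any other
member-uniform choice rescales `C₄` by an absolute constant); (iii) constants crude; (iv) NOT a claim about the stub, the crux or the mass gap.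

References: T. Bałaban, CMP **102** (1985) 277–309 [Balaban1985Variational] (5) p.278, (26)–(27) p.282, Prop. 4 (90)–(98) pp.291–293, Sect. F p.302.
-/

set_option autoImplicit false

noncomputable section

open scoped BigOperators Matrix.Norms.L2Operator
open NormedSpace Finset

namespace Summit.QuantumFields.YangMills.Theorems.FlatProp4Bg1

open Literature.MathematicalPhysics.QuantumFieldTheory.Balaban1983to89
open Summit.QuantumFields.YangMills.Theorems.FlatPlaqCubic
open Summit.QuantumFields.YangMills.Theorems.FlatPlaqDeriv
open Summit.QuantumFields.YangMills.Theorems.FlatPlaqIncidence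
open Summit.QuantumFields.YangMills.BalabanUVNodes.N09OneDefectAveraging (shift_ne_self)

variable {P : Params} {j : ℕ}

/-! ## §1 Torus facts: a shifted site is a different site (tree: `shift_ne_self`); the four edges of a plaquette are pairwise distinct -/

/-- `x − e_ν ≠ x` on the torus. [folklore] -/
theorem unshift_ne_self (x : Site P j) (ν : Fin P.d) : x.unshift ν ≠ x := by
  intro h
  have := shift_ne_self (x.unshift ν) ν
  rw [Site.shift_unshift] at this
  exact this h.symm

/-! ## §2 Smoothness of `𝒱_η` -/

section Smooth

variable (η : ℝ)

/-- The exponential of `M₂(ℂ)` is `C²` (it is analytic). [folklore] -/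
theorem contDiff_exp_two : ContDiff ℂ 2 (fun X : Matrix (Fin 2) (Fin 2) ℂ => exp X) :=
  contDiff_iff_contDiffAt.2 fun X => (NormedSpace.exp_analytic (𝕂 := ℂ) X).contDiffAt

/-- **`𝒱_η` IS `C²`** (a finite sum of traces of products of exponentials of linear images of `A`, and polynomials).
[cite: Balaban1985Variational, p.282 («an entire function of A»)] -/
theorem contDiff_V : ContDiff ℂ 2 (fun A : PBond P j → Matrix (Fin 2) (Fin 2) ℂ => (∑ p : Plaq P j, (1 - (2 : ℂ)⁻¹ * Matrix.trace (exp ((Complex.I * (η : ℂ)) • A ⟨p.src, p.μ⟩) * exp ((Complex.I * (η : ℂ)) • A ⟨p.src.shift p.μ, p.ν⟩) * exp (-((Complex.I * (η : ℂ)) • A ⟨p.src.shift p.ν, p.μ⟩)) * exp (-((Complex.I * (η : ℂ)) • A ⟨p.src, p.ν⟩))) + (2 : ℂ)⁻¹ * Matrix.trace (((Complex.I * (η : ℂ)) • A ⟨p.src, p.μ⟩) + ((Complex.I * (η : ℂ)) • A ⟨p.src.shift p.μ, p.ν⟩) + (-((Complex.I * (η : ℂ)) • A ⟨p.src.shift p.ν,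 p.μ⟩)) + (-((Complex.I * (η : ℂ)) • A ⟨p.src, p.ν⟩))) + (4 : ℂ)⁻¹ * Matrix.trace ((((Complex.I * (η : ℂ)) • A ⟨p.src, p.μ⟩) + ((Complex.I * (η : ℂ)) • A ⟨p.src.shift p.μ, p.ν⟩) + (-((Complex.I * (η : ℂ)) • A ⟨p.src.shift p.ν, p.μ⟩)) + (-((Complex.I * (η : ℂ)) • A ⟨p.src, p.ν⟩))) ^ 2)))) := by
  have hT : ContDiff ℂ 2 (fun X : Matrix (Fin 2) (Fin 2) ℂ => Matrix.trace X) :=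
    (LinearMap.toContinuousLinearMap (Matrix.traceLinearMap (Fin 2) ℂ ℂ)).contDiff
  have hev : ∀ b : PBond P j, ContDiff ℂ 2 (fun A : PBond P j → Matrix (Fin 2) (Fin 2) ℂ => A b) := fun b => contDiff_apply ℂ (Matrix (Fin 2) (Fin 2) ℂ) b
  have hE := contDiff_exp_two
  refine ContDiff.sum fun p _ => ?_
  have h1 : ContDiff ℂ 2 (fun A : PBond P j → Matrix (Fin 2) (Fin 2) ℂ => ((Complex.I * (η : ℂ)) • A ⟨p.src, p.μ⟩)) := (hev _).const_smul _
  have h2 : ContDiff ℂ 2 (fun A : PBond P j → Matrix (Fin 2) (Fin 2) ℂ => ((Complex.I * (η : ℂ)) • A ⟨p.src.shift p.μ, p.ν⟩)) := (hev _).const_smul _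
  have h3 : ContDiff ℂ 2 (fun A : PBond P j → Matrix (Fin 2) (Fin 2) ℂ => (-((Complex.I * (η : ℂ)) • A ⟨p.src.shift p.ν, p.μ⟩))) := ((hev _).const_smul _).neg
  have h4 : ContDiff ℂ 2 (fun A : PBond P j → Matrix (Fin 2) (Fin 2) ℂ => (-((Complex.I * (η : ℂ)) • A ⟨p.src, p.ν⟩))) := ((hev _).const_smul _).neg
  have hS := ((h1.add h2).add h3).add h4
  have hprod := (((hE.comp h1).mul (hE.comp h2)).mul (hE.comp h3)).mul (hE.comp h4)
  have h := ((contDiff_const (c := (1 : ℂ))).sub ((hT.comp hprod).const_smul ((2 : ℂ)⁻¹))).add ((hT.comp hS).const_smul ((2 : ℂ)⁻¹))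
    |>.add ((hT.comp (hS.pow 2)).const_smul ((4 : ℂ)⁻¹))
  simpa only [Function.comp_def, smul_eq_mul] using h

/-- `𝒱_η` is differentiable. [cite: Balaban1985Variational, p.282] -/
theorem differentiable_V : Differentiable ℂ (fun A : PBond P j → Matrix (Fin 2) (Fin 2) ℂ => (∑ p : Plaq P j, (1 - (2 : ℂ)⁻¹ * Matrix.trace (exp ((Complex.I * (η : ℂ)) • A ⟨p.src, p.μ⟩) * exp ((Complex.I * (η : ℂ)) • A ⟨p.src.shift p.μ, p.ν⟩) * exp (-((Complex.I * (η : ℂ)) • A ⟨p.src.shift p.ν, p.μ⟩)) * exp (-((Complex.I * (η : ℂ)) • A ⟨p.src, p.ν⟩))) + (2 : ℂ)⁻¹ * Matrix.trace (((Complex.I * (η : ℂ)) • A ⟨p.src, p.μ⟩) + ((Complex.I * (η : ℂ)) • A ⟨p.src.shift p.μ, p.ν⟩) + (-((Complex.I * (η : ℂ)) • A ⟨p.src.shift p.ν, p.μ⟩)) + (-((Complex.I * (η : ℂ)) • A ⟨p.src, p.ν⟩))) + (4 : ℂ)⁻¹ * Matrix.trace ((((Complex.I * (η : ℂ)) • A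 ⟨p.src, p.μ⟩) + ((Complex.I * (η : ℂ)) • A ⟨p.src.shift p.μ, p.ν⟩) + (-((Complex.I * (η : ℂ)) • A ⟨p.src.shift p.ν, p.μ⟩)) + (-((Complex.I * (η : ℂ)) • A ⟨p.src, p.ν⟩))) ^ 2)))) :=
  (contDiff_V η).differentiable (by norm_num)

end Smooth

/-! ## §3 The derivative of `𝒱_η` along a line `A + tδ` is the sum of the per-plaquette line derivatives -/

section Line

variable (η : ℝ)

/-- Each slot is linear in the field: `slotᵢ(A + tδ) = slotᵢ(A) + t·slotᵢ(δ)`, so `𝒱_η(A + tδ) = Σ_p 𝔣(slots(A) + t·slots(δ))`. [folklore] -/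
theorem V_line (A δ : PBond P j → Matrix (Fin 2) (Fin 2) ℂ) :
    (fun t : ℂ => (fun A : PBond P j → Matrix (Fin 2) (Fin 2) ℂ => (∑ p : Plaq P j, (1 - (2 : ℂ)⁻¹ * Matrix.trace (exp ((Complex.I * (η : ℂ)) • A ⟨p.src, p.μ⟩) * exp ((Complex.I * (η : ℂ)) • A ⟨p.src.shift p.μ, p.ν⟩) * exp (-((Complex.I * (η : ℂ)) • A ⟨p.src.shift p.ν, p.μ⟩)) * exp (-((Complex.I * (η : ℂ)) • A ⟨p.src, p.ν⟩))) + (2 : ℂ)⁻¹ * Matrix.trace (((Complex.I * (η : ℂ)) • A ⟨p.src, p.μ⟩) + ((Complex.I * (η : ℂ)) • A ⟨p.src.shift p.μ, p.ν⟩) + (-((Complex.I * (η : ℂ)) • A ⟨p.src.shift p.ν, p.μ⟩)) + (-((Complex.I * (η : ℂ)) • A ⟨p.src, p.ν⟩))) + (4 : ℂ)⁻¹ * Matrix.trace ((((Complex.I * (η : ℂ)) • A ⟨p.src, p.μ⟩) + ((Complex.I * (η : ℂ)) • A ⟨p.src.shift p.μ, p.ν⟩) + (-((Complex.I * (η : ℂ))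 • A ⟨p.src.shift p.ν, p.μ⟩)) + (-((Complex.I * (η : ℂ)) • A ⟨p.src, p.ν⟩))) ^ 2)))) (A + t • δ)) = fun t : ℂ => ∑ p : Plaq P j, (1 - (2 : ℂ)⁻¹ * Matrix.trace (exp (((Complex.I * (η : ℂ)) • A ⟨p.src, p.μ⟩) + t • ((Complex.I * (η : ℂ)) • δ ⟨p.src, p.μ⟩)) * exp (((Complex.I * (η : ℂ)) • A ⟨p.src.shift p.μ, p.ν⟩) + t • ((Complex.I * (η : ℂ)) • δ ⟨p.src.shift p.μ, p.ν⟩)) * exp ((-((Complex.I * (η : ℂ)) • A ⟨p.src.shift p.ν, p.μ⟩)) + t • (-((Complex.I * (η : ℂ)) • δ ⟨p.src.shift p.ν, p.μ⟩))) * exp ((-((Complex.I * (η : ℂ)) • A ⟨p.src, p.ν⟩)) + t • (-((Complex.I * (η : ℂ)) • δ ⟨p.src, p.ν⟩)))) + (2 : ℂ)⁻¹ * Matrix.trace ((((Complex.I * (η : ℂ)) • A ⟨p.src, p.μ⟩) + t • ((Complex.I * (η : ℂ)) • δ ⟨p.src, p.μ⟩)) + (((Complex.I * (η : ℂ)) •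 A ⟨p.src.shift p.μ, p.ν⟩) + t • ((Complex.I * (η : ℂ)) • δ ⟨p.src.shift p.μ, p.ν⟩)) + ((-((Complex.I * (η : ℂ)) • A ⟨p.src.shift p.ν, p.μ⟩)) + t • (-((Complex.I * (η : ℂ)) • δ ⟨p.src.shift p.ν, p.μ⟩))) + ((-((Complex.I * (η : ℂ)) • A ⟨p.src, p.ν⟩)) + t • (-((Complex.I * (η : ℂ)) • δ ⟨p.src, p.ν⟩)))) + (4 : ℂ)⁻¹ * Matrix.trace (((((Complex.I * (η : ℂ)) • A ⟨p.src, p.μ⟩) + t • ((Complex.I * (η : ℂ)) • δ ⟨p.src, p.μ⟩)) + (((Complex.I * (η : ℂ)) • A ⟨p.src.shift p.μ, p.ν⟩) + t • ((Complex.I * (η : ℂ)) • δ ⟨p.src.shift p.μ, p.ν⟩)) + ((-((Complex.I * (η : ℂ)) • A ⟨p.src.shift p.ν, p.μ⟩)) + t • (-((Complex.I * (η : ℂ)) • δ ⟨p.src.shift p.ν, p.μ⟩))) + ((-((Complex.I * (η : ℂ)) • A ⟨p.src, p.ν⟩)) + t • (-((Complex.I * (η : ℂ)) • δ ⟨p.src,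 p.ν⟩)))) ^ 2)) := by
  funext t
  refine sum_congr rfl fun p _ => ?_
  have e1 : ((Complex.I * (η : ℂ)) • (A + t • δ) ⟨p.src, p.μ⟩) = (((Complex.I * (η : ℂ)) • A ⟨p.src, p.μ⟩) + t • ((Complex.I * (η : ℂ)) • δ ⟨p.src, p.μ⟩)) := by
    simp only [Pi.add_apply, Pi.smul_apply, smul_add, smul_comm (Complex.I * (η : ℂ)) t]
  have e2 : ((Complex.I * (η : ℂ)) • (A + t • δ) ⟨p.src.shift p.μ, p.ν⟩) = (((Complex.I * (η : ℂ)) • A ⟨p.src.shift p.μ, p.ν⟩) + t • ((Complex.I * (η : ℂ)) • δ ⟨p.src.shift p.μ, p.ν⟩)) := by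
    simp only [Pi.add_apply, Pi.smul_apply, smul_add, smul_comm (Complex.I * (η : ℂ)) t]
  have e3 : (-((Complex.I * (η : ℂ)) • (A + t • δ) ⟨p.src.shift p.ν, p.μ⟩)) = ((-((Complex.I * (η : ℂ)) • A ⟨p.src.shift p.ν, p.μ⟩)) + t • (-((Complex.I * (η : ℂ)) • δ ⟨p.src.shift p.ν, p.μ⟩))) := by
    simp only [Pi.add_apply, Pi.smul_apply, smul_add, smul_comm (Complex.I * (η : ℂ)) t, neg_add, smul_neg]
  have e4 : (-((Complex.I * (η : ℂ)) • (A + t • δ) ⟨p.src, p.ν⟩)) = ((-((Complex.I * (η : ℂ)) • A ⟨p.src, p.ν⟩)) + t • (-((Complex.I * (η : ℂ)) • δ ⟨p.src, p.ν⟩))) := by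
    simp only [Pi.add_apply, Pi.smul_apply, smul_add, smul_comm (Complex.I * (η : ℂ)) t, neg_add, smul_neg]
  rw [e1, e2, e3, e4]

/-- **`D𝒱_η(A)[δ] = Σ_p d/dt 𝔣(slots_p(A) + t·slots_p(δ))|₀`** (chain rule along the line and the sum rule). [folklore] -/
theorem fderiv_V_eq_sum (A δ : PBond P j → Matrix (Fin 2) (Fin 2) ℂ) :
    fderiv ℂ (fun A : PBond P j → Matrix (Fin 2) (Fin 2) ℂ => (∑ p : Plaq P j, (1 - (2 : ℂ)⁻¹ * Matrix.trace (exp ((Complex.I * (η : ℂ)) • A ⟨p.src, p.μ⟩) * exp ((Complex.I * (η : ℂ)) • A ⟨p.src.shift p.μ, p.ν⟩) * exp (-((Complex.I * (η : ℂ)) • A ⟨p.src.shift p.ν, p.μ⟩)) * exp (-((Complex.I * (η : ℂ)) • A ⟨p.src, p.ν⟩))) + (2 : ℂ)⁻¹ * Matrix.trace (((Complex.I * (η : ℂ)) • A ⟨p.src, p.μ⟩) + ((Complex.I * (η : ℂ)) • A ⟨p.src.shift p.μ, p.ν⟩) + (-((Complex.I * (η : ℂ)) • A ⟨p.src.shift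 p.ν, p.μ⟩)) + (-((Complex.I * (η : ℂ)) • A ⟨p.src, p.ν⟩))) + (4 : ℂ)⁻¹ * Matrix.trace ((((Complex.I * (η : ℂ)) • A ⟨p.src, p.μ⟩) + ((Complex.I * (η : ℂ)) • A ⟨p.src.shift p.μ, p.ν⟩) + (-((Complex.I * (η : ℂ)) • A ⟨p.src.shift p.ν, p.μ⟩)) + (-((Complex.I * (η : ℂ)) • A ⟨p.src, p.ν⟩))) ^ 2)))) A δ = ∑ p : Plaq P j, deriv (fun t : ℂ => (1 - (2 : ℂ)⁻¹ * Matrix.trace (exp (((Complex.I * (η : ℂ)) • A ⟨p.src, p.μ⟩) + t • ((Complex.I * (η : ℂ)) • δ ⟨p.src, p.μ⟩)) * exp (((Complex.I * (η : ℂ)) • A ⟨p.src.shift p.μ, p.ν⟩) + t • ((Complex.I * (η : ℂ)) • δ ⟨p.src.shift p.μ, p.ν⟩)) * exp ((-((Complex.I * (η : ℂ)) • A ⟨p.src.shift p.ν, p.μ⟩)) + t • (-((Complex.I * (η : ℂ)) • δ ⟨p.src.shift p.ν, p.μ⟩))) * exp ((-((Complex.I * (η : ℂ)) • A ⟨p.src,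 p.ν⟩)) + t • (-((Complex.I * (η : ℂ)) • δ ⟨p.src, p.ν⟩)))) + (2 : ℂ)⁻¹ * Matrix.trace ((((Complex.I * (η : ℂ)) • A ⟨p.src, p.μ⟩) + t • ((Complex.I * (η : ℂ)) • δ ⟨p.src, p.μ⟩)) + (((Complex.I * (η : ℂ)) • A ⟨p.src.shift p.μ, p.ν⟩) + t • ((Complex.I * (η : ℂ)) • δ ⟨p.src.shift p.μ, p.ν⟩)) + ((-((Complex.I * (η : ℂ)) • A ⟨p.src.shift p.ν, p.μ⟩)) + t • (-((Complex.I * (η : ℂ)) • δ ⟨p.src.shift p.ν, p.μ⟩))) + ((-((Complex.I * (η : ℂ)) • A ⟨p.src, p.ν⟩)) + t • (-((Complex.I * (η : ℂ)) • δ ⟨p.src, p.ν⟩)))) + (4 : ℂ)⁻¹ * Matrix.trace (((((Complex.I * (η : ℂ)) • A ⟨p.src, p.μ⟩) + t • ((Complex.I * (η : ℂ)) • δ ⟨p.src, p.μ⟩)) + (((Complex.I * (η : ℂ)) • A ⟨p.src.shift p.μ, p.ν⟩) + t • ((Complex.I * (η : ℂ)) • δ ⟨p.src.shift p.μ, p.ν⟩))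 + ((-((Complex.I * (η : ℂ)) • A ⟨p.src.shift p.ν, p.μ⟩)) + t • (-((Complex.I * (η : ℂ)) • δ ⟨p.src.shift p.ν, p.μ⟩))) + ((-((Complex.I * (η : ℂ)) • A ⟨p.src, p.ν⟩)) + t • (-((Complex.I * (η : ℂ)) • δ ⟨p.src, p.ν⟩)))) ^ 2))) 0 := by
  have hline : HasDerivAt (fun t : ℂ => A + t • δ) δ 0 := by
    simpa using ((hasDerivAt_id (0 : ℂ)).smul_const δ).const_add A
  have h1 : HasDerivAt (fun t : ℂ => (fun A : PBond P j → Matrix (Fin 2) (Fin 2) ℂ => (∑ p : Plaq P j, (1 - (2 : ℂ)⁻¹ * Matrix.trace (exp ((Complex.I * (η : ℂ)) • A ⟨p.src, p.μ⟩) * exp ((Complex.I * (η : ℂ)) • A ⟨p.src.shift p.μ, p.ν⟩) * exp (-((Complex.I * (η : ℂ)) • A ⟨p.src.shift p.ν, p.μ⟩)) * exp (-((Complex.I * (η : ℂ)) • A ⟨p.src, p.ν⟩))) + (2 : ℂ)⁻¹ * Matrix.trace (((Complex.I * (η : ℂ)) • A ⟨p.src, p.μ⟩) + ((Complex.I * (η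 : ℂ)) • A ⟨p.src.shift p.μ, p.ν⟩) + (-((Complex.I * (η : ℂ)) • A ⟨p.src.shift p.ν, p.μ⟩)) + (-((Complex.I * (η : ℂ)) • A ⟨p.src, p.ν⟩))) + (4 : ℂ)⁻¹ * Matrix.trace ((((Complex.I * (η : ℂ)) • A ⟨p.src, p.μ⟩) + ((Complex.I * (η : ℂ)) • A ⟨p.src.shift p.μ, p.ν⟩) + (-((Complex.I * (η : ℂ)) • A ⟨p.src.shift p.ν, p.μ⟩)) + (-((Complex.I * (η : ℂ)) • A ⟨p.src, p.ν⟩))) ^ 2)))) (A + t • δ))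
      (fderiv ℂ (fun A : PBond P j → Matrix (Fin 2) (Fin 2) ℂ => (∑ p : Plaq P j, (1 - (2 : ℂ)⁻¹ * Matrix.trace (exp ((Complex.I * (η : ℂ)) • A ⟨p.src, p.μ⟩) * exp ((Complex.I * (η : ℂ)) • A ⟨p.src.shift p.μ, p.ν⟩) * exp (-((Complex.I * (η : ℂ)) • A ⟨p.src.shift p.ν, p.μ⟩)) * exp (-((Complex.I * (η : ℂ)) • A ⟨p.src, p.ν⟩))) + (2 : ℂ)⁻¹ * Matrix.trace (((Complex.I * (η : ℂ)) • A ⟨p.src, p.μ⟩) + ((Complex.I * (η : ℂ)) • A ⟨p.src.shift p.μ, p.ν⟩) + (-((Complex.I * (η : ℂ)) • A ⟨p.src.shift p.ν, p.μ⟩)) + (-((Complex.I * (η : ℂ)) • A ⟨p.src, p.ν⟩))) + (4 : ℂ)⁻¹ * Matrix.trace ((((Complex.I * (η : ℂ)) • A ⟨p.src, p.μ⟩) + ((Complex.I * (η : ℂ)) • A ⟨p.src.shift p.μ, p.ν⟩) + (-((Complex.I * (η : ℂ)) • A ⟨p.src.shift p.ν, p.μ⟩)) + (-((Complex.I * (η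 : ℂ)) • A ⟨p.src, p.ν⟩))) ^ 2)))) A δ) 0 := by
    have h := (differentiable_V η (A + (0 : ℂ) • δ)).hasFDerivAt.comp_hasDerivAt (0 : ℂ) hline
    simpa only [Function.comp_def, zero_smul, add_zero] using h
  have h2 : HasDerivAt (fun t : ℂ => (fun A : PBond P j → Matrix (Fin 2) (Fin 2) ℂ => (∑ p : Plaq P j, (1 - (2 : ℂ)⁻¹ * Matrix.trace (exp ((Complex.I * (η : ℂ)) • A ⟨p.src, p.μ⟩) * exp ((Complex.I * (η : ℂ)) • A ⟨p.src.shift p.μ, p.ν⟩) * exp (-((Complex.I * (η : ℂ)) • A ⟨p.src.shift p.ν, p.μ⟩)) * exp (-((Complex.I * (η : ℂ)) • A ⟨p.src, p.ν⟩))) + (2 : ℂ)⁻¹ * Matrix.trace (((Complex.I * (η : ℂ)) • A ⟨p.src, p.μ⟩) + ((Complex.I * (η : ℂ)) • A ⟨p.src.shift p.μ, p.ν⟩) + (-((Complex.I * (η : ℂ)) • A ⟨p.src.shift p.ν, p.μ⟩)) + (-((Complex.I * (η : ℂ)) • A ⟨p.src, p.ν⟩))) + (4 : ℂ)⁻¹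 * Matrix.trace ((((Complex.I * (η : ℂ)) • A ⟨p.src, p.μ⟩) + ((Complex.I * (η : ℂ)) • A ⟨p.src.shift p.μ, p.ν⟩) + (-((Complex.I * (η : ℂ)) • A ⟨p.src.shift p.ν, p.μ⟩)) + (-((Complex.I * (η : ℂ)) • A ⟨p.src, p.ν⟩))) ^ 2)))) (A + t • δ))
      (∑ p : Plaq P j, deriv (fun t : ℂ => (1 - (2 : ℂ)⁻¹ * Matrix.trace (exp (((Complex.I * (η : ℂ)) • A ⟨p.src, p.μ⟩) + t • ((Complex.I * (η : ℂ)) • δ ⟨p.src, p.μ⟩)) * exp (((Complex.I * (η : ℂ)) • A ⟨p.src.shift p.μ, p.ν⟩) + t • ((Complex.I * (η : ℂ)) • δ ⟨p.src.shift p.μ, p.ν⟩)) * exp ((-((Complex.I * (η : ℂ)) • A ⟨p.src.shift p.ν, p.μ⟩)) + t • (-((Complex.I * (η : ℂ)) • δ ⟨p.src.shift p.ν, p.μ⟩))) * exp ((-((Complex.I * (η : ℂ)) • A ⟨p.src, p.ν⟩)) + t • (-((Complex.I * (η : ℂ)) • δ ⟨p.src, p.ν⟩)))) + (2 : ℂ)⁻¹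 * Matrix.trace ((((Complex.I * (η : ℂ)) • A ⟨p.src, p.μ⟩) + t • ((Complex.I * (η : ℂ)) • δ ⟨p.src, p.μ⟩)) + (((Complex.I * (η : ℂ)) • A ⟨p.src.shift p.μ, p.ν⟩) + t • ((Complex.I * (η : ℂ)) • δ ⟨p.src.shift p.μ, p.ν⟩)) + ((-((Complex.I * (η : ℂ)) • A ⟨p.src.shift p.ν, p.μ⟩)) + t • (-((Complex.I * (η : ℂ)) • δ ⟨p.src.shift p.ν, p.μ⟩))) + ((-((Complex.I * (η : ℂ)) • A ⟨p.src, p.ν⟩)) + t • (-((Complex.I * (η : ℂ)) • δ ⟨p.src, p.ν⟩)))) + (4 : ℂ)⁻¹ * Matrix.trace (((((Complex.I * (η : ℂ)) • A ⟨p.src, p.μ⟩) + t • ((Complex.I * (η : ℂ)) • δ ⟨p.src, p.μ⟩)) + (((Complex.I * (η : ℂ)) • A ⟨p.src.shift p.μ, p.ν⟩) + t • ((Complex.I * (η : ℂ)) • δ ⟨p.src.shift p.μ, p.ν⟩)) + ((-((Complex.I * (η : ℂ)) • A ⟨p.src.shift p.ν, p.μ⟩)) + t • (-((Complex.I * (η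 : ℂ)) • δ ⟨p.src.shift p.ν, p.μ⟩))) + ((-((Complex.I * (η : ℂ)) • A ⟨p.src, p.ν⟩)) + t • (-((Complex.I * (η : ℂ)) • δ ⟨p.src, p.ν⟩)))) ^ 2))) 0) 0 := by
    rw [V_line η A δ]
    exact HasDerivAt.fun_sum fun p _ => ((differentiable_frak_line4 _ _ _ _ _ _ _ _) 0).hasDerivAt
  exact h1.unique h2

end Line

/-! ## §4 The line derivative at a single bond: support and the (plane, ±) pairing -/

section SingleBond

variable (η : ℝ) [DecidableEq (PBond P j)]

omit [DecidableEq (PBond P j)] in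
/-- The four edges of a plaquette are pairwise distinct (directions differ, or the sites differ by a unit translation). [folklore] -/
theorem edges_pairwise_ne (p : Plaq P j) :
    (⟨p.src, p.μ⟩ : PBond P j) ≠ ⟨p.src.shift p.μ, p.ν⟩ ∧ (⟨p.src, p.μ⟩ : PBond P j) ≠ ⟨p.src.shift p.ν, p.μ⟩ ∧
    (⟨p.src, p.μ⟩ : PBond P j) ≠ ⟨p.src, p.ν⟩ ∧ (⟨p.src.shift p.μ, p.ν⟩ : PBond P j) ≠ ⟨p.src.shift p.ν, p.μ⟩ ∧
    (⟨p.src.shift p.μ, p.ν⟩ : PBond P j) ≠ ⟨p.src, p.ν⟩ ∧ (⟨p.src.shift p.ν, p.μ⟩ : PBond P j) ≠ ⟨p.src, p.ν⟩ := by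
  have hμν : p.μ ≠ p.ν := ne_of_lt p.hμν
  refine ⟨?_, ?_, ?_, ?_, ?_, ?_⟩ <;> intro h <;> simp only [PBond.mk.injEq] at h
  · exact hμν h.2
  · exact shift_ne_self p.src p.ν h.1.symm
  · exact hμν h.2
  · exact hμν h.2.symm
  · exact shift_ne_self p.src p.μ h.1
  · exact hμν h.2

omit [DecidableEq (PBond P j)] in
/-- A value attached to at most one of four exclusive events, vanishing off all of them, is the sum of its four indicators. [folklore] -/
theorem eq_sum_ite4 {M' : Type*} [AddCommMonoid M'] (a : M') (P1 P2 P3 P4 : Prop) [Decidable P1] [Decidable P2] [Decidable P3] [Decidable P4]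
    (h0 : ¬P1 → ¬P2 → ¬P3 → ¬P4 → a = 0) (h12 : P1 → P2 → False) (h13 : P1 → P3 → False) (h14 : P1 → P4 → False)
    (h23 : P2 → P3 → False) (h24 : P2 → P4 → False) (h34 : P3 → P4 → False) :
    a = (if P1 then a else 0) + (if P2 then a else 0) + (if P3 then a else 0) + (if P4 then a else 0) := by
  by_cases p1 : P1 <;> by_cases p2 : P2 <;> by_cases p3 : P3 <;> by_cases p4 : P4 <;>
    simp_all

/-- **Support**: a plaquette not containing the bond `b` contributes nothing to the derivative along `1_b E`. [folklore] -/
theorem deriv_line_single_eq_zero (A : PBond P j → Matrix (Fin 2) (Fin 2) ℂ) (b : PBond P j) (E : Matrix (Fin 2) (Fin 2) ℂ) (p : Plaq P j)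
    (h1 : (⟨p.src, p.μ⟩ : PBond P j) ≠ b) (h2 : (⟨p.src.shift p.μ, p.ν⟩ : PBond P j) ≠ b)
    (h3 : (⟨p.src.shift p.ν, p.μ⟩ : PBond P j) ≠ b) (h4 : (⟨p.src, p.ν⟩ : PBond P j) ≠ b) :
    deriv (fun t : ℂ => (1 - (2 : ℂ)⁻¹ * Matrix.trace (exp (((Complex.I * (η : ℂ)) • A ⟨p.src, p.μ⟩) + t • ((Complex.I * (η : ℂ)) • (Pi.single b E : PBond P j → Matrix (Fin 2) (Fin 2) ℂ) ⟨p.src, p.μ⟩)) * exp (((Complex.I * (η : ℂ)) • A ⟨p.src.shift p.μ, p.ν⟩) + t • ((Complex.I * (η : ℂ)) • (Pi.single b E : PBond P j → Matrix (Fin 2) (Fin 2) ℂ) ⟨p.src.shift p.μ, p.ν⟩)) * exp ((-((Complex.I * (η : ℂ)) • A ⟨p.src.shift p.ν, p.μ⟩)) + t • (-((Complex.I * (η : ℂ)) • (Pi.single b E : PBond P j → Matrix (Fin 2) (Fin 2) ℂ) ⟨p.src.shift p.ν, p.μ⟩))) * exp ((-((Complex.I * (η : ℂ)) • A ⟨p.src,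 p.ν⟩)) + t • (-((Complex.I * (η : ℂ)) • (Pi.single b E : PBond P j → Matrix (Fin 2) (Fin 2) ℂ) ⟨p.src, p.ν⟩)))) + (2 : ℂ)⁻¹ * Matrix.trace ((((Complex.I * (η : ℂ)) • A ⟨p.src, p.μ⟩) + t • ((Complex.I * (η : ℂ)) • (Pi.single b E : PBond P j → Matrix (Fin 2) (Fin 2) ℂ) ⟨p.src, p.μ⟩)) + (((Complex.I * (η : ℂ)) • A ⟨p.src.shift p.μ, p.ν⟩) + t • ((Complex.I * (η : ℂ)) • (Pi.single b E : PBond P j → Matrix (Fin 2) (Fin 2) ℂ) ⟨p.src.shift p.μ, p.ν⟩)) + ((-((Complex.I * (η : ℂ)) • A ⟨p.src.shift p.ν, p.μ⟩)) + t • (-((Complex.I * (η : ℂ)) • (Pi.single b E : PBond P j → Matrix (Fin 2) (Fin 2) ℂ) ⟨p.src.shift p.ν, p.μ⟩))) + ((-((Complex.I * (η : ℂ)) • A ⟨p.src, p.ν⟩)) + t • (-((Complex.I * (η : ℂ)) • (Pi.single b E : PBond P j → Matrix (Fin 2) (Fin 2) ℂ) ⟨p.src, p.ν⟩)))) + (4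 : ℂ)⁻¹ * Matrix.trace (((((Complex.I * (η : ℂ)) • A ⟨p.src, p.μ⟩) + t • ((Complex.I * (η : ℂ)) • (Pi.single b E : PBond P j → Matrix (Fin 2) (Fin 2) ℂ) ⟨p.src, p.μ⟩)) + (((Complex.I * (η : ℂ)) • A ⟨p.src.shift p.μ, p.ν⟩) + t • ((Complex.I * (η : ℂ)) • (Pi.single b E : PBond P j → Matrix (Fin 2) (Fin 2) ℂ) ⟨p.src.shift p.μ, p.ν⟩)) + ((-((Complex.I * (η : ℂ)) • A ⟨p.src.shift p.ν, p.μ⟩)) + t • (-((Complex.I * (η : ℂ)) • (Pi.single b E : PBond P j → Matrix (Fin 2) (Fin 2) ℂ) ⟨p.src.shift p.ν, p.μ⟩))) + ((-((Complex.I * (η : ℂ)) • A ⟨p.src, p.ν⟩)) + t • (-((Complex.I * (η : ℂ)) • (Pi.single b E : PBond P j → Matrix (Fin 2) (Fin 2) ℂ) ⟨p.src, p.ν⟩)))) ^ 2))) 0 = 0 := by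
  simp only [Pi.single_apply, if_neg h1, if_neg h2, if_neg h3, if_neg h4, smul_zero, neg_zero, add_zero, deriv_const]

/-- **THE PER-BOND LINE DERIVATIVE AS A SUM OVER THE (PLANE, ±) PAIRS** (support + `FlatPlaqIncidence.sum_plaq_slots_eq_pairs`).
[cite: Balaban1985Variational, (90) p.291, (93)-(96) p.292] -/
theorem sum_deriv_line_single_eq_pairs (A : PBond P j → Matrix (Fin 2) (Fin 2) ℂ) (b : PBond P j) (E : Matrix (Fin 2) (Fin 2) ℂ) :
    ∑ p : Plaq P j, deriv (fun t : ℂ => (1 - (2 : ℂ)⁻¹ * Matrix.trace (exp (((Complex.I * (η : ℂ)) • A ⟨p.src, p.μ⟩) + t • ((Complex.I * (η : ℂ)) • (Pi.single b E : PBond P j → Matrix (Fin 2) (Fin 2) ℂ) ⟨p.src, p.μ⟩)) * exp (((Complex.I * (η : ℂ)) • A ⟨p.src.shift p.μ, p.ν⟩) + t • ((Complex.I * (η : ℂ)) • (Pi.single b E : PBond P j → Matrix (Fin 2) (Fin 2) ℂ) ⟨p.src.shift p.μ, p.ν⟩)) * exp ((-((Complex.I * (η : ℂ)) • A ⟨p.src.shift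 p.ν, p.μ⟩)) + t • (-((Complex.I * (η : ℂ)) • (Pi.single b E : PBond P j → Matrix (Fin 2) (Fin 2) ℂ) ⟨p.src.shift p.ν, p.μ⟩))) * exp ((-((Complex.I * (η : ℂ)) • A ⟨p.src, p.ν⟩)) + t • (-((Complex.I * (η : ℂ)) • (Pi.single b E : PBond P j → Matrix (Fin 2) (Fin 2) ℂ) ⟨p.src, p.ν⟩)))) + (2 : ℂ)⁻¹ * Matrix.trace ((((Complex.I * (η : ℂ)) • A ⟨p.src, p.μ⟩) + t • ((Complex.I * (η : ℂ)) • (Pi.single b E : PBond P j → Matrix (Fin 2) (Fin 2) ℂ) ⟨p.src, p.μ⟩)) + (((Complex.I * (η : ℂ)) • A ⟨p.src.shift p.μ, p.ν⟩) + t • ((Complex.I * (η : ℂ)) • (Pi.single b E : PBond P j → Matrix (Fin 2) (Fin 2) ℂ) ⟨p.src.shift p.μ, p.ν⟩)) + ((-((Complex.I * (η : ℂ)) • A ⟨p.src.shift p.ν, p.μ⟩)) + t • (-((Complex.I * (η : ℂ)) • (Pi.single b E : PBond P j → Matrix (Fin 2) (Fin 2) ℂ) ⟨p.src.shift p.ν,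 p.μ⟩))) + ((-((Complex.I * (η : ℂ)) • A ⟨p.src, p.ν⟩)) + t • (-((Complex.I * (η : ℂ)) • (Pi.single b E : PBond P j → Matrix (Fin 2) (Fin 2) ℂ) ⟨p.src, p.ν⟩)))) + (4 : ℂ)⁻¹ * Matrix.trace (((((Complex.I * (η : ℂ)) • A ⟨p.src, p.μ⟩) + t • ((Complex.I * (η : ℂ)) • (Pi.single b E : PBond P j → Matrix (Fin 2) (Fin 2) ℂ) ⟨p.src, p.μ⟩)) + (((Complex.I * (η : ℂ)) • A ⟨p.src.shift p.μ, p.ν⟩) + t • ((Complex.I * (η : ℂ)) • (Pi.single b E : PBond P j → Matrix (Fin 2) (Fin 2) ℂ) ⟨p.src.shift p.μ, p.ν⟩)) + ((-((Complex.I * (η : ℂ)) • A ⟨p.src.shift p.ν, p.μ⟩)) + t • (-((Complex.I * (η : ℂ)) • (Pi.single b E : PBond P j → Matrix (Fin 2) (Fin 2) ℂ) ⟨p.src.shift p.ν, p.μ⟩))) + ((-((Complex.I * (η : ℂ)) • A ⟨p.src, p.ν⟩)) + t • (-((Complex.I * (η : ℂ)) • (Pi.single b E : PBond P j → Matrix (Fin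 2) (Fin 2) ℂ) ⟨p.src, p.ν⟩)))) ^ 2))) 0 =
      ∑ ν : Fin P.d, ((if h : b.dir < ν then deriv (fun t : ℂ => (1 - (2 : ℂ)⁻¹ * Matrix.trace (exp (((Complex.I * (η : ℂ)) • A ⟨(⟨b.src, b.dir, ν, h⟩ : Plaq P j).src, (⟨b.src, b.dir, ν, h⟩ : Plaq P j).μ⟩) + t • ((Complex.I * (η : ℂ)) • (Pi.single b E : PBond P j → Matrix (Fin 2) (Fin 2) ℂ) ⟨(⟨b.src, b.dir, ν, h⟩ : Plaq P j).src, (⟨b.src, b.dir, ν, h⟩ : Plaq P j).μ⟩)) * exp (((Complex.I * (η : ℂ)) • A ⟨(⟨b.src, b.dir, ν, h⟩ : Plaq P j).src.shift (⟨b.src, b.dir, ν, h⟩ : Plaq P j).μ, (⟨b.src, b.dir, ν, h⟩ : Plaq P j).ν⟩) + t • ((Complex.I * (η : ℂ)) • (Pi.single b E : PBond P j → Matrix (Fin 2) (Fin 2) ℂ) ⟨(⟨b.src, b.dir, ν, h⟩ : Plaq P j).src.shift (⟨b.src, b.dir, ν, h⟩ : Plaq P j).μ, (⟨b.src, b.dir,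 ν, h⟩ : Plaq P j).ν⟩)) * exp ((-((Complex.I * (η : ℂ)) • A ⟨(⟨b.src, b.dir, ν, h⟩ : Plaq P j).src.shift (⟨b.src, b.dir, ν, h⟩ : Plaq P j).ν, (⟨b.src, b.dir, ν, h⟩ : Plaq P j).μ⟩)) + t • (-((Complex.I * (η : ℂ)) • (Pi.single b E : PBond P j → Matrix (Fin 2) (Fin 2) ℂ) ⟨(⟨b.src, b.dir, ν, h⟩ : Plaq P j).src.shift (⟨b.src, b.dir, ν, h⟩ : Plaq P j).ν, (⟨b.src, b.dir, ν, h⟩ : Plaq P j).μ⟩))) * exp ((-((Complex.I * (η : ℂ)) • A ⟨(⟨b.src, b.dir, ν, h⟩ : Plaq P j).src, (⟨b.src, b.dir, ν, h⟩ : Plaq P j).ν⟩)) + t • (-((Complex.I * (η : ℂ)) • (Pi.single b E : PBond P j → Matrix (Fin 2) (Fin 2) ℂ) ⟨(⟨b.src, b.dir, ν, h⟩ : Plaq P j).src, (⟨b.src, b.dir, ν, h⟩ : Plaq P j).ν⟩)))) + (2 : ℂ)⁻¹ * Matrix.trace ((((Complex.I * (η : ℂ)) • A ⟨(⟨b.src,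 b.dir, ν, h⟩ : Plaq P j).src, (⟨b.src, b.dir, ν, h⟩ : Plaq P j).μ⟩) + t • ((Complex.I * (η : ℂ)) • (Pi.single b E : PBond P j → Matrix (Fin 2) (Fin 2) ℂ) ⟨(⟨b.src, b.dir, ν, h⟩ : Plaq P j).src, (⟨b.src, b.dir, ν, h⟩ : Plaq P j).μ⟩)) + (((Complex.I * (η : ℂ)) • A ⟨(⟨b.src, b.dir, ν, h⟩ : Plaq P j).src.shift (⟨b.src, b.dir, ν, h⟩ : Plaq P j).μ, (⟨b.src, b.dir, ν, h⟩ : Plaq P j).ν⟩) + t • ((Complex.I * (η : ℂ)) • (Pi.single b E : PBond P j → Matrix (Fin 2) (Fin 2) ℂ) ⟨(⟨b.src, b.dir, ν, h⟩ : Plaq P j).src.shift (⟨b.src, b.dir, ν, h⟩ : Plaq P j).μ, (⟨b.src, b.dir, ν, h⟩ : Plaq P j).ν⟩)) + ((-((Complex.I * (η : ℂ)) • A ⟨(⟨b.src, b.dir, ν, h⟩ : Plaq P j).src.shift (⟨b.src, b.dir, ν, h⟩ : Plaq P j).ν, (⟨b.src, b.dir, ν, h⟩ : Plaq P j).μ⟩))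 + t • (-((Complex.I * (η : ℂ)) • (Pi.single b E : PBond P j → Matrix (Fin 2) (Fin 2) ℂ) ⟨(⟨b.src, b.dir, ν, h⟩ : Plaq P j).src.shift (⟨b.src, b.dir, ν, h⟩ : Plaq P j).ν, (⟨b.src, b.dir, ν, h⟩ : Plaq P j).μ⟩))) + ((-((Complex.I * (η : ℂ)) • A ⟨(⟨b.src, b.dir, ν, h⟩ : Plaq P j).src, (⟨b.src, b.dir, ν, h⟩ : Plaq P j).ν⟩)) + t • (-((Complex.I * (η : ℂ)) • (Pi.single b E : PBond P j → Matrix (Fin 2) (Fin 2) ℂ) ⟨(⟨b.src, b.dir, ν, h⟩ : Plaq P j).src, (⟨b.src, b.dir, ν, h⟩ : Plaq P j).ν⟩)))) + (4 : ℂ)⁻¹ * Matrix.trace (((((Complex.I * (η : ℂ)) • A ⟨(⟨b.src, b.dir, ν, h⟩ : Plaq P j).src, (⟨b.src, b.dir, ν, h⟩ : Plaq P j).μ⟩) + t • ((Complex.I * (η : ℂ)) • (Pi.single b E : PBond P j → Matrix (Fin 2) (Fin 2) ℂ) ⟨(⟨b.src, b.dir, ν, h⟩ : Plaq P j).src, (⟨b.src,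 b.dir, ν, h⟩ : Plaq P j).μ⟩)) + (((Complex.I * (η : ℂ)) • A ⟨(⟨b.src, b.dir, ν, h⟩ : Plaq P j).src.shift (⟨b.src, b.dir, ν, h⟩ : Plaq P j).μ, (⟨b.src, b.dir, ν, h⟩ : Plaq P j).ν⟩) + t • ((Complex.I * (η : ℂ)) • (Pi.single b E : PBond P j → Matrix (Fin 2) (Fin 2) ℂ) ⟨(⟨b.src, b.dir, ν, h⟩ : Plaq P j).src.shift (⟨b.src, b.dir, ν, h⟩ : Plaq P j).μ, (⟨b.src, b.dir, ν, h⟩ : Plaq P j).ν⟩)) + ((-((Complex.I * (η : ℂ)) • A ⟨(⟨b.src, b.dir, ν, h⟩ : Plaq P j).src.shift (⟨b.src, b.dir, ν, h⟩ : Plaq P j).ν, (⟨b.src, b.dir, ν, h⟩ : Plaq P j).μ⟩)) + t • (-((Complex.I * (η : ℂ)) • (Pi.single b E : PBond P j → Matrix (Fin 2) (Fin 2) ℂ) ⟨(⟨b.src, b.dir, ν, h⟩ : Plaq P j).src.shift (⟨b.src, b.dir, ν, h⟩ : Plaq P j).ν, (⟨b.src, b.dir, ν, h⟩ : Plaq P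 j).μ⟩))) + ((-((Complex.I * (η : ℂ)) • A ⟨(⟨b.src, b.dir, ν, h⟩ : Plaq P j).src, (⟨b.src, b.dir, ν, h⟩ : Plaq P j).ν⟩)) + t • (-((Complex.I * (η : ℂ)) • (Pi.single b E : PBond P j → Matrix (Fin 2) (Fin 2) ℂ) ⟨(⟨b.src, b.dir, ν, h⟩ : Plaq P j).src, (⟨b.src, b.dir, ν, h⟩ : Plaq P j).ν⟩)))) ^ 2))) 0 + deriv (fun t : ℂ => (1 - (2 : ℂ)⁻¹ * Matrix.trace (exp (((Complex.I * (η : ℂ)) • A ⟨(⟨b.src.unshift ν, b.dir, ν, h⟩ : Plaq P j).src, (⟨b.src.unshift ν, b.dir, ν, h⟩ : Plaq P j).μ⟩) + t • ((Complex.I * (η : ℂ)) • (Pi.single b E : PBond P j → Matrix (Fin 2) (Fin 2) ℂ) ⟨(⟨b.src.unshift ν, b.dir, ν, h⟩ : Plaq P j).src, (⟨b.src.unshift ν, b.dir, ν, h⟩ : Plaq P j).μ⟩)) * exp (((Complex.I * (η : ℂ)) • A ⟨(⟨b.src.unshift ν, b.dir, ν, h⟩ : Plaq P j).src.shift (⟨b.src.unshift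 ν, b.dir, ν, h⟩ : Plaq P j).μ, (⟨b.src.unshift ν, b.dir, ν, h⟩ : Plaq P j).ν⟩) + t • ((Complex.I * (η : ℂ)) • (Pi.single b E : PBond P j → Matrix (Fin 2) (Fin 2) ℂ) ⟨(⟨b.src.unshift ν, b.dir, ν, h⟩ : Plaq P j).src.shift (⟨b.src.unshift ν, b.dir, ν, h⟩ : Plaq P j).μ, (⟨b.src.unshift ν, b.dir, ν, h⟩ : Plaq P j).ν⟩)) * exp ((-((Complex.I * (η : ℂ)) • A ⟨(⟨b.src.unshift ν, b.dir, ν, h⟩ : Plaq P j).src.shift (⟨b.src.unshift ν, b.dir, ν, h⟩ : Plaq P j).ν, (⟨b.src.unshift ν, b.dir, ν, h⟩ : Plaq P j).μ⟩)) + t • (-((Complex.I * (η : ℂ)) • (Pi.single b E : PBond P j → Matrix (Fin 2) (Fin 2) ℂ) ⟨(⟨b.src.unshift ν, b.dir, ν, h⟩ : Plaq P j).src.shift (⟨b.src.unshift ν, b.dir, ν, h⟩ : Plaq P j).ν, (⟨b.src.unshift ν, b.dir, ν, h⟩ : Plaq P j).μ⟩))) * exp ((-((Complex.I * (η : ℂ))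 • A ⟨(⟨b.src.unshift ν, b.dir, ν, h⟩ : Plaq P j).src, (⟨b.src.unshift ν, b.dir, ν, h⟩ : Plaq P j).ν⟩)) + t • (-((Complex.I * (η : ℂ)) • (Pi.single b E : PBond P j → Matrix (Fin 2) (Fin 2) ℂ) ⟨(⟨b.src.unshift ν, b.dir, ν, h⟩ : Plaq P j).src, (⟨b.src.unshift ν, b.dir, ν, h⟩ : Plaq P j).ν⟩)))) + (2 : ℂ)⁻¹ * Matrix.trace ((((Complex.I * (η : ℂ)) • A ⟨(⟨b.src.unshift ν, b.dir, ν, h⟩ : Plaq P j).src, (⟨b.src.unshift ν, b.dir, ν, h⟩ : Plaq P j).μ⟩) + t • ((Complex.I * (η : ℂ)) • (Pi.single b E : PBond P j → Matrix (Fin 2) (Fin 2) ℂ) ⟨(⟨b.src.unshift ν, b.dir, ν, h⟩ : Plaq P j).src, (⟨b.src.unshift ν, b.dir, ν, h⟩ : Plaq P j).μ⟩)) + (((Complex.I * (η : ℂ)) • A ⟨(⟨b.src.unshift ν, b.dir, ν, h⟩ : Plaq P j).src.shift (⟨b.src.unshift ν, b.dir, ν, h⟩ : Plaq P j).μ, (⟨b.src.unshift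 ν, b.dir, ν, h⟩ : Plaq P j).ν⟩) + t • ((Complex.I * (η : ℂ)) • (Pi.single b E : PBond P j → Matrix (Fin 2) (Fin 2) ℂ) ⟨(⟨b.src.unshift ν, b.dir, ν, h⟩ : Plaq P j).src.shift (⟨b.src.unshift ν, b.dir, ν, h⟩ : Plaq P j).μ, (⟨b.src.unshift ν, b.dir, ν, h⟩ : Plaq P j).ν⟩)) + ((-((Complex.I * (η : ℂ)) • A ⟨(⟨b.src.unshift ν, b.dir, ν, h⟩ : Plaq P j).src.shift (⟨b.src.unshift ν, b.dir, ν, h⟩ : Plaq P j).ν, (⟨b.src.unshift ν, b.dir, ν, h⟩ : Plaq P j).μ⟩)) + t • (-((Complex.I * (η : ℂ)) • (Pi.single b E : PBond P j → Matrix (Fin 2) (Fin 2) ℂ) ⟨(⟨b.src.unshift ν, b.dir, ν, h⟩ : Plaq P j).src.shift (⟨b.src.unshift ν, b.dir, ν, h⟩ : Plaq P j).ν, (⟨b.src.unshift ν, b.dir, ν, h⟩ : Plaq P j).μ⟩))) + ((-((Complex.I * (η : ℂ)) • A ⟨(⟨b.src.unshift ν, b.dir, ν, h⟩ : Plaq P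 j).src, (⟨b.src.unshift ν, b.dir, ν, h⟩ : Plaq P j).ν⟩)) + t • (-((Complex.I * (η : ℂ)) • (Pi.single b E : PBond P j → Matrix (Fin 2) (Fin 2) ℂ) ⟨(⟨b.src.unshift ν, b.dir, ν, h⟩ : Plaq P j).src, (⟨b.src.unshift ν, b.dir, ν, h⟩ : Plaq P j).ν⟩)))) + (4 : ℂ)⁻¹ * Matrix.trace (((((Complex.I * (η : ℂ)) • A ⟨(⟨b.src.unshift ν, b.dir, ν, h⟩ : Plaq P j).src, (⟨b.src.unshift ν, b.dir, ν, h⟩ : Plaq P j).μ⟩) + t • ((Complex.I * (η : ℂ)) • (Pi.single b E : PBond P j → Matrix (Fin 2) (Fin 2) ℂ) ⟨(⟨b.src.unshift ν, b.dir, ν, h⟩ : Plaq P j).src, (⟨b.src.unshift ν, b.dir, ν, h⟩ : Plaq P j).μ⟩)) + (((Complex.I * (η : ℂ)) • A ⟨(⟨b.src.unshift ν, b.dir, ν, h⟩ : Plaq P j).src.shift (⟨b.src.unshift ν, b.dir, ν, h⟩ : Plaq P j).μ, (⟨b.src.unshift ν, b.dir, ν, h⟩ : Plaq P j).ν⟩)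 + t • ((Complex.I * (η : ℂ)) • (Pi.single b E : PBond P j → Matrix (Fin 2) (Fin 2) ℂ) ⟨(⟨b.src.unshift ν, b.dir, ν, h⟩ : Plaq P j).src.shift (⟨b.src.unshift ν, b.dir, ν, h⟩ : Plaq P j).μ, (⟨b.src.unshift ν, b.dir, ν, h⟩ : Plaq P j).ν⟩)) + ((-((Complex.I * (η : ℂ)) • A ⟨(⟨b.src.unshift ν, b.dir, ν, h⟩ : Plaq P j).src.shift (⟨b.src.unshift ν, b.dir, ν, h⟩ : Plaq P j).ν, (⟨b.src.unshift ν, b.dir, ν, h⟩ : Plaq P j).μ⟩)) + t • (-((Complex.I * (η : ℂ)) • (Pi.single b E : PBond P j → Matrix (Fin 2) (Fin 2) ℂ) ⟨(⟨b.src.unshift ν, b.dir, ν, h⟩ : Plaq P j).src.shift (⟨b.src.unshift ν, b.dir, ν, h⟩ : Plaq P j).ν, (⟨b.src.unshift ν, b.dir, ν, h⟩ : Plaq P j).μ⟩))) + ((-((Complex.I * (η : ℂ)) • A ⟨(⟨b.src.unshift ν, b.dir, ν, h⟩ : Plaq P j).src, (⟨b.src.unshift ν, b.dir, ν, h⟩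 : Plaq P j).ν⟩)) + t • (-((Complex.I * (η : ℂ)) • (Pi.single b E : PBond P j → Matrix (Fin 2) (Fin 2) ℂ) ⟨(⟨b.src.unshift ν, b.dir, ν, h⟩ : Plaq P j).src, (⟨b.src.unshift ν, b.dir, ν, h⟩ : Plaq P j).ν⟩)))) ^ 2))) 0 else 0)
        + (if h : ν < b.dir then deriv (fun t : ℂ => (1 - (2 : ℂ)⁻¹ * Matrix.trace (exp (((Complex.I * (η : ℂ)) • A ⟨(⟨b.src.unshift ν, ν, b.dir, h⟩ : Plaq P j).src, (⟨b.src.unshift ν, ν, b.dir, h⟩ : Plaq P j).μ⟩) + t • ((Complex.I * (η : ℂ)) • (Pi.single b E : PBond P j → Matrix (Fin 2) (Fin 2) ℂ) ⟨(⟨b.src.unshift ν, ν, b.dir, h⟩ : Plaq P j).src, (⟨b.src.unshift ν, ν, b.dir, h⟩ : Plaq P j).μ⟩)) * exp (((Complex.I * (η : ℂ)) • A ⟨(⟨b.src.unshift ν, ν, b.dir, h⟩ : Plaq P j).src.shift (⟨b.src.unshift ν, ν, b.dir, h⟩ : Plaq P j).μ, (⟨b.src.unshift ν, ν, b.dir,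 h⟩ : Plaq P j).ν⟩) + t • ((Complex.I * (η : ℂ)) • (Pi.single b E : PBond P j → Matrix (Fin 2) (Fin 2) ℂ) ⟨(⟨b.src.unshift ν, ν, b.dir, h⟩ : Plaq P j).src.shift (⟨b.src.unshift ν, ν, b.dir, h⟩ : Plaq P j).μ, (⟨b.src.unshift ν, ν, b.dir, h⟩ : Plaq P j).ν⟩)) * exp ((-((Complex.I * (η : ℂ)) • A ⟨(⟨b.src.unshift ν, ν, b.dir, h⟩ : Plaq P j).src.shift (⟨b.src.unshift ν, ν, b.dir, h⟩ : Plaq P j).ν, (⟨b.src.unshift ν, ν, b.dir, h⟩ : Plaq P j).μ⟩)) + t • (-((Complex.I * (η : ℂ)) • (Pi.single b E : PBond P j → Matrix (Fin 2) (Fin 2) ℂ) ⟨(⟨b.src.unshift ν, ν, b.dir, h⟩ : Plaq P j).src.shift (⟨b.src.unshift ν, ν, b.dir, h⟩ : Plaq P j).ν, (⟨b.src.unshift ν, ν, b.dir, h⟩ : Plaq P j).μ⟩))) * exp ((-((Complex.I * (η : ℂ)) • A ⟨(⟨b.src.unshift ν, ν, b.dir, h⟩ : Plaq P j).src, (⟨b.src.unshift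 ν, ν, b.dir, h⟩ : Plaq P j).ν⟩)) + t • (-((Complex.I * (η : ℂ)) • (Pi.single b E : PBond P j → Matrix (Fin 2) (Fin 2) ℂ) ⟨(⟨b.src.unshift ν, ν, b.dir, h⟩ : Plaq P j).src, (⟨b.src.unshift ν, ν, b.dir, h⟩ : Plaq P j).ν⟩)))) + (2 : ℂ)⁻¹ * Matrix.trace ((((Complex.I * (η : ℂ)) • A ⟨(⟨b.src.unshift ν, ν, b.dir, h⟩ : Plaq P j).src, (⟨b.src.unshift ν, ν, b.dir, h⟩ : Plaq P j).μ⟩) + t • ((Complex.I * (η : ℂ)) • (Pi.single b E : PBond P j → Matrix (Fin 2) (Fin 2) ℂ) ⟨(⟨b.src.unshift ν, ν, b.dir, h⟩ : Plaq P j).src, (⟨b.src.unshift ν, ν, b.dir, h⟩ : Plaq P j).μ⟩)) + (((Complex.I * (η : ℂ)) • A ⟨(⟨b.src.unshift ν, ν, b.dir, h⟩ : Plaq P j).src.shift (⟨b.src.unshift ν, ν, b.dir, h⟩ : Plaq P j).μ, (⟨b.src.unshift ν, ν, b.dir, h⟩ : Plaq P j).ν⟩) + t • ((Complex.I * (η :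 ℂ)) • (Pi.single b E : PBond P j → Matrix (Fin 2) (Fin 2) ℂ) ⟨(⟨b.src.unshift ν, ν, b.dir, h⟩ : Plaq P j).src.shift (⟨b.src.unshift ν, ν, b.dir, h⟩ : Plaq P j).μ, (⟨b.src.unshift ν, ν, b.dir, h⟩ : Plaq P j).ν⟩)) + ((-((Complex.I * (η : ℂ)) • A ⟨(⟨b.src.unshift ν, ν, b.dir, h⟩ : Plaq P j).src.shift (⟨b.src.unshift ν, ν, b.dir, h⟩ : Plaq P j).ν, (⟨b.src.unshift ν, ν, b.dir, h⟩ : Plaq P j).μ⟩)) + t • (-((Complex.I * (η : ℂ)) • (Pi.single b E : PBond P j → Matrix (Fin 2) (Fin 2) ℂ) ⟨(⟨b.src.unshift ν, ν, b.dir, h⟩ : Plaq P j).src.shift (⟨b.src.unshift ν, ν, b.dir, h⟩ : Plaq P j).ν, (⟨b.src.unshift ν, ν, b.dir, h⟩ : Plaq P j).μ⟩))) + ((-((Complex.I * (η : ℂ)) • A ⟨(⟨b.src.unshift ν, ν, b.dir, h⟩ : Plaq P j).src, (⟨b.src.unshift ν, ν, b.dir, h⟩ : Plaq P j).ν⟩))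 + t • (-((Complex.I * (η : ℂ)) • (Pi.single b E : PBond P j → Matrix (Fin 2) (Fin 2) ℂ) ⟨(⟨b.src.unshift ν, ν, b.dir, h⟩ : Plaq P j).src, (⟨b.src.unshift ν, ν, b.dir, h⟩ : Plaq P j).ν⟩)))) + (4 : ℂ)⁻¹ * Matrix.trace (((((Complex.I * (η : ℂ)) • A ⟨(⟨b.src.unshift ν, ν, b.dir, h⟩ : Plaq P j).src, (⟨b.src.unshift ν, ν, b.dir, h⟩ : Plaq P j).μ⟩) + t • ((Complex.I * (η : ℂ)) • (Pi.single b E : PBond P j → Matrix (Fin 2) (Fin 2) ℂ) ⟨(⟨b.src.unshift ν, ν, b.dir, h⟩ : Plaq P j).src, (⟨b.src.unshift ν, ν, b.dir, h⟩ : Plaq P j).μ⟩)) + (((Complex.I * (η : ℂ)) • A ⟨(⟨b.src.unshift ν, ν, b.dir, h⟩ : Plaq P j).src.shift (⟨b.src.unshift ν, ν, b.dir, h⟩ : Plaq P j).μ, (⟨b.src.unshift ν, ν, b.dir, h⟩ : Plaq P j).ν⟩) + t • ((Complex.I * (η : ℂ)) • (Pi.single b E : PBond P j → Matrix (Fin 2)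 (Fin 2) ℂ) ⟨(⟨b.src.unshift ν, ν, b.dir, h⟩ : Plaq P j).src.shift (⟨b.src.unshift ν, ν, b.dir, h⟩ : Plaq P j).μ, (⟨b.src.unshift ν, ν, b.dir, h⟩ : Plaq P j).ν⟩)) + ((-((Complex.I * (η : ℂ)) • A ⟨(⟨b.src.unshift ν, ν, b.dir, h⟩ : Plaq P j).src.shift (⟨b.src.unshift ν, ν, b.dir, h⟩ : Plaq P j).ν, (⟨b.src.unshift ν, ν, b.dir, h⟩ : Plaq P j).μ⟩)) + t • (-((Complex.I * (η : ℂ)) • (Pi.single b E : PBond P j → Matrix (Fin 2) (Fin 2) ℂ) ⟨(⟨b.src.unshift ν, ν, b.dir, h⟩ : Plaq P j).src.shift (⟨b.src.unshift ν, ν, b.dir, h⟩ : Plaq P j).ν, (⟨b.src.unshift ν, ν, b.dir, h⟩ : Plaq P j).μ⟩))) + ((-((Complex.I * (η : ℂ)) • A ⟨(⟨b.src.unshift ν, ν, b.dir, h⟩ : Plaq P j).src, (⟨b.src.unshift ν, ν, b.dir, h⟩ : Plaq P j).ν⟩)) + t • (-((Complex.I * (η : ℂ)) • (Pi.single b E :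 PBond P j → Matrix (Fin 2) (Fin 2) ℂ) ⟨(⟨b.src.unshift ν, ν, b.dir, h⟩ : Plaq P j).src, (⟨b.src.unshift ν, ν, b.dir, h⟩ : Plaq P j).ν⟩)))) ^ 2))) 0 + deriv (fun t : ℂ => (1 - (2 : ℂ)⁻¹ * Matrix.trace (exp (((Complex.I * (η : ℂ)) • A ⟨(⟨b.src, ν, b.dir, h⟩ : Plaq P j).src, (⟨b.src, ν, b.dir, h⟩ : Plaq P j).μ⟩) + t • ((Complex.I * (η : ℂ)) • (Pi.single b E : PBond P j → Matrix (Fin 2) (Fin 2) ℂ) ⟨(⟨b.src, ν, b.dir, h⟩ : Plaq P j).src, (⟨b.src, ν, b.dir, h⟩ : Plaq P j).μ⟩)) * exp (((Complex.I * (η : ℂ)) • A ⟨(⟨b.src, ν, b.dir, h⟩ : Plaq P j).src.shift (⟨b.src, ν, b.dir, h⟩ : Plaq P j).μ, (⟨b.src, ν, b.dir, h⟩ : Plaq P j).ν⟩) + t • ((Complex.I * (η : ℂ)) • (Pi.single b E : PBond P j → Matrix (Fin 2) (Fin 2) ℂ) ⟨(⟨b.src, ν, b.dir, h⟩ : Plaq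 P j).src.shift (⟨b.src, ν, b.dir, h⟩ : Plaq P j).μ, (⟨b.src, ν, b.dir, h⟩ : Plaq P j).ν⟩)) * exp ((-((Complex.I * (η : ℂ)) • A ⟨(⟨b.src, ν, b.dir, h⟩ : Plaq P j).src.shift (⟨b.src, ν, b.dir, h⟩ : Plaq P j).ν, (⟨b.src, ν, b.dir, h⟩ : Plaq P j).μ⟩)) + t • (-((Complex.I * (η : ℂ)) • (Pi.single b E : PBond P j → Matrix (Fin 2) (Fin 2) ℂ) ⟨(⟨b.src, ν, b.dir, h⟩ : Plaq P j).src.shift (⟨b.src, ν, b.dir, h⟩ : Plaq P j).ν, (⟨b.src, ν, b.dir, h⟩ : Plaq P j).μ⟩))) * exp ((-((Complex.I * (η : ℂ)) • A ⟨(⟨b.src, ν, b.dir, h⟩ : Plaq P j).src, (⟨b.src, ν, b.dir, h⟩ : Plaq P j).ν⟩)) + t • (-((Complex.I * (η : ℂ)) • (Pi.single b E : PBond P j → Matrix (Fin 2) (Fin 2) ℂ) ⟨(⟨b.src, ν, b.dir, h⟩ : Plaq P j).src, (⟨b.src, ν, b.dir, h⟩ : Plaq P j).ν⟩)))) + (2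 : ℂ)⁻¹ * Matrix.trace ((((Complex.I * (η : ℂ)) • A ⟨(⟨b.src, ν, b.dir, h⟩ : Plaq P j).src, (⟨b.src, ν, b.dir, h⟩ : Plaq P j).μ⟩) + t • ((Complex.I * (η : ℂ)) • (Pi.single b E : PBond P j → Matrix (Fin 2) (Fin 2) ℂ) ⟨(⟨b.src, ν, b.dir, h⟩ : Plaq P j).src, (⟨b.src, ν, b.dir, h⟩ : Plaq P j).μ⟩)) + (((Complex.I * (η : ℂ)) • A ⟨(⟨b.src, ν, b.dir, h⟩ : Plaq P j).src.shift (⟨b.src, ν, b.dir, h⟩ : Plaq P j).μ, (⟨b.src, ν, b.dir, h⟩ : Plaq P j).ν⟩) + t • ((Complex.I * (η : ℂ)) • (Pi.single b E : PBond P j → Matrix (Fin 2) (Fin 2) ℂ) ⟨(⟨b.src, ν, b.dir, h⟩ : Plaq P j).src.shift (⟨b.src, ν, b.dir, h⟩ : Plaq P j).μ, (⟨b.src, ν, b.dir, h⟩ : Plaq P j).ν⟩)) + ((-((Complex.I * (η : ℂ)) • A ⟨(⟨b.src, ν, b.dir, h⟩ : Plaq P j).src.shift (⟨b.src, ν, b.dir,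 h⟩ : Plaq P j).ν, (⟨b.src, ν, b.dir, h⟩ : Plaq P j).μ⟩)) + t • (-((Complex.I * (η : ℂ)) • (Pi.single b E : PBond P j → Matrix (Fin 2) (Fin 2) ℂ) ⟨(⟨b.src, ν, b.dir, h⟩ : Plaq P j).src.shift (⟨b.src, ν, b.dir, h⟩ : Plaq P j).ν, (⟨b.src, ν, b.dir, h⟩ : Plaq P j).μ⟩))) + ((-((Complex.I * (η : ℂ)) • A ⟨(⟨b.src, ν, b.dir, h⟩ : Plaq P j).src, (⟨b.src, ν, b.dir, h⟩ : Plaq P j).ν⟩)) + t • (-((Complex.I * (η : ℂ)) • (Pi.single b E : PBond P j → Matrix (Fin 2) (Fin 2) ℂ) ⟨(⟨b.src, ν, b.dir, h⟩ : Plaq P j).src, (⟨b.src, ν, b.dir, h⟩ : Plaq P j).ν⟩)))) + (4 : ℂ)⁻¹ * Matrix.trace (((((Complex.I * (η : ℂ)) • A ⟨(⟨b.src, ν, b.dir, h⟩ : Plaq P j).src, (⟨b.src, ν, b.dir, h⟩ : Plaq P j).μ⟩) + t • ((Complex.I * (η : ℂ)) • (Pi.single b E : PBond P j → Matrix (Fin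 2) (Fin 2) ℂ) ⟨(⟨b.src, ν, b.dir, h⟩ : Plaq P j).src, (⟨b.src, ν, b.dir, h⟩ : Plaq P j).μ⟩)) + (((Complex.I * (η : ℂ)) • A ⟨(⟨b.src, ν, b.dir, h⟩ : Plaq P j).src.shift (⟨b.src, ν, b.dir, h⟩ : Plaq P j).μ, (⟨b.src, ν, b.dir, h⟩ : Plaq P j).ν⟩) + t • ((Complex.I * (η : ℂ)) • (Pi.single b E : PBond P j → Matrix (Fin 2) (Fin 2) ℂ) ⟨(⟨b.src, ν, b.dir, h⟩ : Plaq P j).src.shift (⟨b.src, ν, b.dir, h⟩ : Plaq P j).μ, (⟨b.src, ν, b.dir, h⟩ : Plaq P j).ν⟩)) + ((-((Complex.I * (η : ℂ)) • A ⟨(⟨b.src, ν, b.dir, h⟩ : Plaq P j).src.shift (⟨b.src, ν, b.dir, h⟩ : Plaq P j).ν, (⟨b.src, ν, b.dir, h⟩ : Plaq P j).μ⟩)) + t • (-((Complex.I * (η : ℂ)) • (Pi.single b E : PBond P j → Matrix (Fin 2) (Fin 2) ℂ) ⟨(⟨b.src, ν, b.dir, h⟩ : Plaq P j).src.shift (⟨b.src,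 ν, b.dir, h⟩ : Plaq P j).ν, (⟨b.src, ν, b.dir, h⟩ : Plaq P j).μ⟩))) + ((-((Complex.I * (η : ℂ)) • A ⟨(⟨b.src, ν, b.dir, h⟩ : Plaq P j).src, (⟨b.src, ν, b.dir, h⟩ : Plaq P j).ν⟩)) + t • (-((Complex.I * (η : ℂ)) • (Pi.single b E : PBond P j → Matrix (Fin 2) (Fin 2) ℂ) ⟨(⟨b.src, ν, b.dir, h⟩ : Plaq P j).src, (⟨b.src, ν, b.dir, h⟩ : Plaq P j).ν⟩)))) ^ 2))) 0 else 0)) := by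
  rw [← sum_plaq_slots_eq_pairs (fun p : Plaq P j => deriv (fun t : ℂ => (1 - (2 : ℂ)⁻¹ * Matrix.trace (exp (((Complex.I * (η : ℂ)) • A ⟨p.src, p.μ⟩) + t • ((Complex.I * (η : ℂ)) • (Pi.single b E : PBond P j → Matrix (Fin 2) (Fin 2) ℂ) ⟨p.src, p.μ⟩)) * exp (((Complex.I * (η : ℂ)) • A ⟨p.src.shift p.μ, p.ν⟩) + t • ((Complex.I * (η : ℂ)) • (Pi.single b E : PBond P j → Matrix (Fin 2) (Fin 2) ℂ) ⟨p.src.shift p.μ, p.ν⟩)) * exp ((-((Complex.I * (η : ℂ)) • A ⟨p.src.shift p.ν, p.μ⟩)) + t • (-((Complex.I * (η : ℂ)) • (Pi.single b E : PBond P j → Matrix (Fin 2) (Fin 2) ℂ) ⟨p.src.shift p.ν, p.μ⟩))) * exp ((-((Complex.I * (η : ℂ)) • A ⟨p.src, p.ν⟩)) + t • (-((Complex.I * (η : ℂ)) • (Pi.single b E : PBond P j → Matrix (Fin 2) (Fin 2) ℂ) ⟨p.src, p.ν⟩)))) + (2 : ℂ)⁻¹ * Matrix.trace ((((Complex.I *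 (η : ℂ)) • A ⟨p.src, p.μ⟩) + t • ((Complex.I * (η : ℂ)) • (Pi.single b E : PBond P j → Matrix (Fin 2) (Fin 2) ℂ) ⟨p.src, p.μ⟩)) + (((Complex.I * (η : ℂ)) • A ⟨p.src.shift p.μ, p.ν⟩) + t • ((Complex.I * (η : ℂ)) • (Pi.single b E : PBond P j → Matrix (Fin 2) (Fin 2) ℂ) ⟨p.src.shift p.μ, p.ν⟩)) + ((-((Complex.I * (η : ℂ)) • A ⟨p.src.shift p.ν, p.μ⟩)) + t • (-((Complex.I * (η : ℂ)) • (Pi.single b E : PBond P j → Matrix (Fin 2) (Fin 2) ℂ) ⟨p.src.shift p.ν, p.μ⟩))) + ((-((Complex.I * (η : ℂ)) • A ⟨p.src, p.ν⟩)) + t • (-((Complex.I * (η : ℂ)) • (Pi.single b E : PBond P j → Matrix (Fin 2) (Fin 2) ℂ) ⟨p.src, p.ν⟩)))) + (4 : ℂ)⁻¹ * Matrix.trace (((((Complex.I * (η : ℂ)) • A ⟨p.src, p.μ⟩) + t • ((Complex.I * (η : ℂ)) • (Pi.single b E : PBond P j → Matrix (Fin 2) (Fin 2) ℂ) ⟨p.src,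 p.μ⟩)) + (((Complex.I * (η : ℂ)) • A ⟨p.src.shift p.μ, p.ν⟩) + t • ((Complex.I * (η : ℂ)) • (Pi.single b E : PBond P j → Matrix (Fin 2) (Fin 2) ℂ) ⟨p.src.shift p.μ, p.ν⟩)) + ((-((Complex.I * (η : ℂ)) • A ⟨p.src.shift p.ν, p.μ⟩)) + t • (-((Complex.I * (η : ℂ)) • (Pi.single b E : PBond P j → Matrix (Fin 2) (Fin 2) ℂ) ⟨p.src.shift p.ν, p.μ⟩))) + ((-((Complex.I * (η : ℂ)) • A ⟨p.src, p.ν⟩)) + t • (-((Complex.I * (η : ℂ)) • (Pi.single b E : PBond P j → Matrix (Fin 2) (Fin 2) ℂ) ⟨p.src, p.ν⟩)))) ^ 2))) 0) b]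
  refine sum_congr rfl fun p _ => ?_
  obtain ⟨n12, n13, n14, n23, n24, n34⟩ := edges_pairwise_ne (P := P) (j := j) p
  exact eq_sum_ite4 _ _ _ _ _ (deriv_line_single_eq_zero η A b E p) (fun a b' => n12 (a.trans b'.symm)) (fun a b' => n13 (a.trans b'.symm))
    (fun a b' => n14 (a.trans b'.symm)) (fun a b' => n23 (a.trans b'.symm)) (fun a b' => n24 (a.trans b'.symm)) (fun a b' => n34 (a.trans b'.symm))

end SingleBond

/-! ## §5 The pair bounds at the lattice: `m = ηr`, `Δ = δ = η²r`, `ρ = r`, `‖H‖ ≤ η` -/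

section Pairs

variable {η : ℝ}

/-- `‖iη·X‖ = η‖X‖` for `η > 0`. [folklore] -/
theorem norm_cI_smul (hη : 0 < η) (X : Matrix (Fin 2) (Fin 2) ℂ) : ‖(Complex.I * (η : ℂ)) • X‖ = η * ‖X‖ := by
  rw [norm_smul, norm_mul, Complex.norm_I, one_mul, Complex.norm_real, Real.norm_eq_abs, abs_of_pos hη]

/-- The arithmetic of one pair: with `m = ηr`, `Δ = δ = η²r`, `ρ = r`, `‖H‖ = h ≤ η ≤ 1`, `0 < r ≤ ½`, the pair bound is `≤ 725η⁴r²`. [folklore] -/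
theorem pair_arith {r h : ℝ} (hη : 0 < η) (hη1 : η ≤ 1) (hr : 0 < r) (hr2 : r ≤ 1 / 2) (h0 : 0 ≤ h) (hh : h ≤ η) :
    h * (16 * (η * r) * (η * (η * r)) + 4 * (η * r) * (η * (η * r)) + (η * (η * r)) ^ 2) + 2 * (44 * (η * r + r * h) ^ 4 / r)
      ≤ 725 * η ^ 4 * r ^ 2 := by
  have e : (η * r + r * h) ^ 4 / r = r ^ 3 * (η + h) ^ 4 := by
    rw [div_eq_iff hr.ne']
    ring
  rw [mul_div_assoc, e]
  have hη4 : 0 ≤ η ^ 4 := by positivity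
  have hr2' : 0 ≤ r ^ 2 := by positivity
  have h1 : h * (16 * (η * r) * (η * (η * r)) + 4 * (η * r) * (η * (η * r)) + (η * (η * r)) ^ 2) ≤ 21 * η ^ 4 * r ^ 2 := by
    have : h * (16 * (η * r) * (η * (η * r)) + 4 * (η * r) * (η * (η * r)) + (η * (η * r)) ^ 2) = (20 * η ^ 3 * h + η ^ 4 * h) * r ^ 2 := by ring
    rw [this]
    refine mul_le_mul_of_nonneg_right ?_ hr2'
    have hη3 : 0 ≤ η ^ 3 := by positivity
    nlinarith [mul_le_mul_of_nonneg_left hh hη3, mul_le_mul_of_nonneg_left hh hη4, mul_le_mul_of_nonneg_left hη1 hη4]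
  have h2 : (η + h) ^ 4 ≤ (2 * η) ^ 4 := pow_le_pow_left₀ (by linarith) (by linarith) 4
  have h3 : 2 * (44 * (r ^ 3 * (η + h) ^ 4)) ≤ 704 * η ^ 4 * r ^ 2 := by
    have hr3 : r ^ 3 ≤ r ^ 2 * (1 / 2) := by nlinarith
    nlinarith [mul_le_mul hr3 h2 (by positivity) (by positivity)]
  linarith

variable [DecidableEq (PBond P j)]

/-- **THE (1,3)-PAIR AT THE LATTICE**: for `b = ⟨x, μ⟩` and `μ < ν`, the plaquettes `p_{μν}(x)` (slot 1) and `p_{μν}(x − e_ν)` (slot 3) contribute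
together at most `725η⁴r²` to `∂_b𝒱_η[E]`, `‖E‖ ≤ 1`, on the (115)-ball of radius `r ∈ (0, ½]`. [cite: Balaban1985Variational, (93)-(96) p.292] -/
theorem norm_pair13_le (hη : 0 < η) (hη1 : η ≤ 1) {r : ℝ} (hr : 0 < r) (hr2 : r ≤ 1 / 2) (A : PBond P j → Matrix (Fin 2) (Fin 2) ℂ)
    (hA : ∀ b, ‖A b‖ ≤ r) (hD : ∀ (s : Site P j) (μ ν : Fin P.d), η⁻¹ * ‖A ⟨s.shift ν, μ⟩ - A ⟨s, μ⟩‖ ≤ r)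
    (E : Matrix (Fin 2) (Fin 2) ℂ) (hE : ‖E‖ ≤ 1) (b : PBond P j) (ν : Fin P.d) (h : b.dir < ν) :
    ‖deriv (fun t : ℂ => (1 - (2 : ℂ)⁻¹ * Matrix.trace (exp (((Complex.I * (η : ℂ)) • A ⟨(⟨b.src, b.dir, ν, h⟩ : Plaq P j).src, (⟨b.src, b.dir, ν, h⟩ : Plaq P j).μ⟩) + t • ((Complex.I * (η : ℂ)) • (Pi.single b E : PBond P j → Matrix (Fin 2) (Fin 2) ℂ) ⟨(⟨b.src, b.dir, ν, h⟩ : Plaq P j).src, (⟨b.src, b.dir, ν, h⟩ : Plaq P j).μ⟩)) * exp (((Complex.I * (η : ℂ)) • A ⟨(⟨b.src, b.dir, ν, h⟩ : Plaq P j).src.shift (⟨b.src, b.dir, ν, h⟩ : Plaq P j).μ, (⟨b.src, b.dir, ν, h⟩ : Plaq P j).ν⟩) + t • ((Complex.I * (η : ℂ)) • (Pi.single b E : PBond P j → Matrix (Fin 2) (Fin 2) ℂ) ⟨(⟨b.src, b.dir, ν, h⟩ : Plaq P j).src.shift (⟨b.src, b.dir, ν, h⟩ : Plaq P j).μ, (⟨b.src,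 b.dir, ν, h⟩ : Plaq P j).ν⟩)) * exp ((-((Complex.I * (η : ℂ)) • A ⟨(⟨b.src, b.dir, ν, h⟩ : Plaq P j).src.shift (⟨b.src, b.dir, ν, h⟩ : Plaq P j).ν, (⟨b.src, b.dir, ν, h⟩ : Plaq P j).μ⟩)) + t • (-((Complex.I * (η : ℂ)) • (Pi.single b E : PBond P j → Matrix (Fin 2) (Fin 2) ℂ) ⟨(⟨b.src, b.dir, ν, h⟩ : Plaq P j).src.shift (⟨b.src, b.dir, ν, h⟩ : Plaq P j).ν, (⟨b.src, b.dir, ν, h⟩ : Plaq P j).μ⟩))) * exp ((-((Complex.I * (η : ℂ)) • A ⟨(⟨b.src, b.dir, ν, h⟩ : Plaq P j).src, (⟨b.src, b.dir, ν, h⟩ : Plaq P j).ν⟩)) + t • (-((Complex.I * (η : ℂ)) • (Pi.single b E : PBond P j → Matrix (Fin 2) (Fin 2) ℂ) ⟨(⟨b.src, b.dir, ν, h⟩ : Plaq P j).src, (⟨b.src, b.dir, ν, h⟩ : Plaq P j).ν⟩)))) + (2 : ℂ)⁻¹ * Matrix.trace ((((Complex.I * (η : ℂ)) • A ⟨(⟨b.src,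 b.dir, ν, h⟩ : Plaq P j).src, (⟨b.src, b.dir, ν, h⟩ : Plaq P j).μ⟩) + t • ((Complex.I * (η : ℂ)) • (Pi.single b E : PBond P j → Matrix (Fin 2) (Fin 2) ℂ) ⟨(⟨b.src, b.dir, ν, h⟩ : Plaq P j).src, (⟨b.src, b.dir, ν, h⟩ : Plaq P j).μ⟩)) + (((Complex.I * (η : ℂ)) • A ⟨(⟨b.src, b.dir, ν, h⟩ : Plaq P j).src.shift (⟨b.src, b.dir, ν, h⟩ : Plaq P j).μ, (⟨b.src, b.dir, ν, h⟩ : Plaq P j).ν⟩) + t • ((Complex.I * (η : ℂ)) • (Pi.single b E : PBond P j → Matrix (Fin 2) (Fin 2) ℂ) ⟨(⟨b.src, b.dir, ν, h⟩ : Plaq P j).src.shift (⟨b.src, b.dir, ν, h⟩ : Plaq P j).μ, (⟨b.src, b.dir, ν, h⟩ : Plaq P j).ν⟩)) + ((-((Complex.I * (η : ℂ)) • A ⟨(⟨b.src, b.dir, ν, h⟩ : Plaq P j).src.shift (⟨b.src, b.dir, ν, h⟩ : Plaq P j).ν, (⟨b.src, b.dir, ν, h⟩ : Plaq P j).μ⟩))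 + t • (-((Complex.I * (η : ℂ)) • (Pi.single b E : PBond P j → Matrix (Fin 2) (Fin 2) ℂ) ⟨(⟨b.src, b.dir, ν, h⟩ : Plaq P j).src.shift (⟨b.src, b.dir, ν, h⟩ : Plaq P j).ν, (⟨b.src, b.dir, ν, h⟩ : Plaq P j).μ⟩))) + ((-((Complex.I * (η : ℂ)) • A ⟨(⟨b.src, b.dir, ν, h⟩ : Plaq P j).src, (⟨b.src, b.dir, ν, h⟩ : Plaq P j).ν⟩)) + t • (-((Complex.I * (η : ℂ)) • (Pi.single b E : PBond P j → Matrix (Fin 2) (Fin 2) ℂ) ⟨(⟨b.src, b.dir, ν, h⟩ : Plaq P j).src, (⟨b.src, b.dir, ν, h⟩ : Plaq P j).ν⟩)))) + (4 : ℂ)⁻¹ * Matrix.trace (((((Complex.I * (η : ℂ)) • A ⟨(⟨b.src, b.dir, ν, h⟩ : Plaq P j).src, (⟨b.src, b.dir, ν, h⟩ : Plaq P j).μ⟩) + t • ((Complex.I * (η : ℂ)) • (Pi.single b E : PBond P j → Matrix (Fin 2) (Fin 2) ℂ) ⟨(⟨b.src, b.dir, ν, h⟩ : Plaq P j).src, (⟨b.src,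 b.dir, ν, h⟩ : Plaq P j).μ⟩)) + (((Complex.I * (η : ℂ)) • A ⟨(⟨b.src, b.dir, ν, h⟩ : Plaq P j).src.shift (⟨b.src, b.dir, ν, h⟩ : Plaq P j).μ, (⟨b.src, b.dir, ν, h⟩ : Plaq P j).ν⟩) + t • ((Complex.I * (η : ℂ)) • (Pi.single b E : PBond P j → Matrix (Fin 2) (Fin 2) ℂ) ⟨(⟨b.src, b.dir, ν, h⟩ : Plaq P j).src.shift (⟨b.src, b.dir, ν, h⟩ : Plaq P j).μ, (⟨b.src, b.dir, ν, h⟩ : Plaq P j).ν⟩)) + ((-((Complex.I * (η : ℂ)) • A ⟨(⟨b.src, b.dir, ν, h⟩ : Plaq P j).src.shift (⟨b.src, b.dir, ν, h⟩ : Plaq P j).ν, (⟨b.src, b.dir, ν, h⟩ : Plaq P j).μ⟩)) + t • (-((Complex.I * (η : ℂ)) • (Pi.single b E : PBond P j → Matrix (Fin 2) (Fin 2) ℂ) ⟨(⟨b.src, b.dir, ν, h⟩ : Plaq P j).src.shift (⟨b.src, b.dir, ν, h⟩ : Plaq P j).ν, (⟨b.src, b.dir, ν, h⟩ : Plaq P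 j).μ⟩))) + ((-((Complex.I * (η : ℂ)) • A ⟨(⟨b.src, b.dir, ν, h⟩ : Plaq P j).src, (⟨b.src, b.dir, ν, h⟩ : Plaq P j).ν⟩)) + t • (-((Complex.I * (η : ℂ)) • (Pi.single b E : PBond P j → Matrix (Fin 2) (Fin 2) ℂ) ⟨(⟨b.src, b.dir, ν, h⟩ : Plaq P j).src, (⟨b.src, b.dir, ν, h⟩ : Plaq P j).ν⟩)))) ^ 2))) 0 + deriv (fun t : ℂ => (1 - (2 : ℂ)⁻¹ * Matrix.trace (exp (((Complex.I * (η : ℂ)) • A ⟨(⟨b.src.unshift ν, b.dir, ν, h⟩ : Plaq P j).src, (⟨b.src.unshift ν, b.dir, ν, h⟩ : Plaq P j).μ⟩) + t • ((Complex.I * (η : ℂ)) • (Pi.single b E : PBond P j → Matrix (Fin 2) (Fin 2) ℂ) ⟨(⟨b.src.unshift ν, b.dir, ν, h⟩ : Plaq P j).src, (⟨b.src.unshift ν, b.dir, ν, h⟩ : Plaq P j).μ⟩)) * exp (((Complex.I * (η : ℂ)) • A ⟨(⟨b.src.unshift ν, b.dir, ν, h⟩ : Plaq P j).src.shift (⟨b.src.unshift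 ν, b.dir, ν, h⟩ : Plaq P j).μ, (⟨b.src.unshift ν, b.dir, ν, h⟩ : Plaq P j).ν⟩) + t • ((Complex.I * (η : ℂ)) • (Pi.single b E : PBond P j → Matrix (Fin 2) (Fin 2) ℂ) ⟨(⟨b.src.unshift ν, b.dir, ν, h⟩ : Plaq P j).src.shift (⟨b.src.unshift ν, b.dir, ν, h⟩ : Plaq P j).μ, (⟨b.src.unshift ν, b.dir, ν, h⟩ : Plaq P j).ν⟩)) * exp ((-((Complex.I * (η : ℂ)) • A ⟨(⟨b.src.unshift ν, b.dir, ν, h⟩ : Plaq P j).src.shift (⟨b.src.unshift ν, b.dir, ν, h⟩ : Plaq P j).ν, (⟨b.src.unshift ν, b.dir, ν, h⟩ : Plaq P j).μ⟩)) + t • (-((Complex.I * (η : ℂ)) • (Pi.single b E : PBond P j → Matrix (Fin 2) (Fin 2) ℂ) ⟨(⟨b.src.unshift ν, b.dir, ν, h⟩ : Plaq P j).src.shift (⟨b.src.unshift ν, b.dir, ν, h⟩ : Plaq P j).ν, (⟨b.src.unshift ν, b.dir, ν, h⟩ : Plaq P j).μ⟩))) * exp ((-((Complex.I * (η : ℂ))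 • A ⟨(⟨b.src.unshift ν, b.dir, ν, h⟩ : Plaq P j).src, (⟨b.src.unshift ν, b.dir, ν, h⟩ : Plaq P j).ν⟩)) + t • (-((Complex.I * (η : ℂ)) • (Pi.single b E : PBond P j → Matrix (Fin 2) (Fin 2) ℂ) ⟨(⟨b.src.unshift ν, b.dir, ν, h⟩ : Plaq P j).src, (⟨b.src.unshift ν, b.dir, ν, h⟩ : Plaq P j).ν⟩)))) + (2 : ℂ)⁻¹ * Matrix.trace ((((Complex.I * (η : ℂ)) • A ⟨(⟨b.src.unshift ν, b.dir, ν, h⟩ : Plaq P j).src, (⟨b.src.unshift ν, b.dir, ν, h⟩ : Plaq P j).μ⟩) + t • ((Complex.I * (η : ℂ)) • (Pi.single b E : PBond P j → Matrix (Fin 2) (Fin 2) ℂ) ⟨(⟨b.src.unshift ν, b.dir, ν, h⟩ : Plaq P j).src, (⟨b.src.unshift ν, b.dir, ν, h⟩ : Plaq P j).μ⟩)) + (((Complex.I * (η : ℂ)) • A ⟨(⟨b.src.unshift ν, b.dir, ν, h⟩ : Plaq P j).src.shift (⟨b.src.unshift ν, b.dir, ν, h⟩ : Plaq P j).μ, (⟨b.src.unshift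 ν, b.dir, ν, h⟩ : Plaq P j).ν⟩) + t • ((Complex.I * (η : ℂ)) • (Pi.single b E : PBond P j → Matrix (Fin 2) (Fin 2) ℂ) ⟨(⟨b.src.unshift ν, b.dir, ν, h⟩ : Plaq P j).src.shift (⟨b.src.unshift ν, b.dir, ν, h⟩ : Plaq P j).μ, (⟨b.src.unshift ν, b.dir, ν, h⟩ : Plaq P j).ν⟩)) + ((-((Complex.I * (η : ℂ)) • A ⟨(⟨b.src.unshift ν, b.dir, ν, h⟩ : Plaq P j).src.shift (⟨b.src.unshift ν, b.dir, ν, h⟩ : Plaq P j).ν, (⟨b.src.unshift ν, b.dir, ν, h⟩ : Plaq P j).μ⟩)) + t • (-((Complex.I * (η : ℂ)) • (Pi.single b E : PBond P j → Matrix (Fin 2) (Fin 2) ℂ) ⟨(⟨b.src.unshift ν, b.dir, ν, h⟩ : Plaq P j).src.shift (⟨b.src.unshift ν, b.dir, ν, h⟩ : Plaq P j).ν, (⟨b.src.unshift ν, b.dir, ν, h⟩ : Plaq P j).μ⟩))) + ((-((Complex.I * (η : ℂ)) • A ⟨(⟨b.src.unshift ν, b.dir, ν, h⟩ : Plaq P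 j).src, (⟨b.src.unshift ν, b.dir, ν, h⟩ : Plaq P j).ν⟩)) + t • (-((Complex.I * (η : ℂ)) • (Pi.single b E : PBond P j → Matrix (Fin 2) (Fin 2) ℂ) ⟨(⟨b.src.unshift ν, b.dir, ν, h⟩ : Plaq P j).src, (⟨b.src.unshift ν, b.dir, ν, h⟩ : Plaq P j).ν⟩)))) + (4 : ℂ)⁻¹ * Matrix.trace (((((Complex.I * (η : ℂ)) • A ⟨(⟨b.src.unshift ν, b.dir, ν, h⟩ : Plaq P j).src, (⟨b.src.unshift ν, b.dir, ν, h⟩ : Plaq P j).μ⟩) + t • ((Complex.I * (η : ℂ)) • (Pi.single b E : PBond P j → Matrix (Fin 2) (Fin 2) ℂ) ⟨(⟨b.src.unshift ν, b.dir, ν, h⟩ : Plaq P j).src, (⟨b.src.unshift ν, b.dir, ν, h⟩ : Plaq P j).μ⟩)) + (((Complex.I * (η : ℂ)) • A ⟨(⟨b.src.unshift ν, b.dir, ν, h⟩ : Plaq P j).src.shift (⟨b.src.unshift ν, b.dir, ν, h⟩ : Plaq P j).μ, (⟨b.src.unshift ν, b.dir, ν, h⟩ : Plaq P j).ν⟩)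 + t • ((Complex.I * (η : ℂ)) • (Pi.single b E : PBond P j → Matrix (Fin 2) (Fin 2) ℂ) ⟨(⟨b.src.unshift ν, b.dir, ν, h⟩ : Plaq P j).src.shift (⟨b.src.unshift ν, b.dir, ν, h⟩ : Plaq P j).μ, (⟨b.src.unshift ν, b.dir, ν, h⟩ : Plaq P j).ν⟩)) + ((-((Complex.I * (η : ℂ)) • A ⟨(⟨b.src.unshift ν, b.dir, ν, h⟩ : Plaq P j).src.shift (⟨b.src.unshift ν, b.dir, ν, h⟩ : Plaq P j).ν, (⟨b.src.unshift ν, b.dir, ν, h⟩ : Plaq P j).μ⟩)) + t • (-((Complex.I * (η : ℂ)) • (Pi.single b E : PBond P j → Matrix (Fin 2) (Fin 2) ℂ) ⟨(⟨b.src.unshift ν, b.dir, ν, h⟩ : Plaq P j).src.shift (⟨b.src.unshift ν, b.dir, ν, h⟩ : Plaq P j).ν, (⟨b.src.unshift ν, b.dir, ν, h⟩ : Plaq P j).μ⟩))) + ((-((Complex.I * (η : ℂ)) • A ⟨(⟨b.src.unshift ν, b.dir, ν, h⟩ : Plaq P j).src, (⟨b.src.unshift ν, b.dir, ν, h⟩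 : Plaq P j).ν⟩)) + t • (-((Complex.I * (η : ℂ)) • (Pi.single b E : PBond P j → Matrix (Fin 2) (Fin 2) ℂ) ⟨(⟨b.src.unshift ν, b.dir, ν, h⟩ : Plaq P j).src, (⟨b.src.unshift ν, b.dir, ν, h⟩ : Plaq P j).ν⟩)))) ^ 2))) 0‖ ≤ 725 * η ^ 4 * r ^ 2 := by
  obtain ⟨x, μ⟩ := b
  have hμν : μ ≠ ν := ne_of_lt h
  have hD' : ∀ (s : Site P j) (μ' ν' : Fin P.d), ‖A ⟨s.shift ν', μ'⟩ - A ⟨s, μ'⟩‖ ≤ η * r := fun s μ' ν' =>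
    (inv_mul_le_iff₀ hη).mp (hD s μ' ν')
  -- the two line functions, with the bond in slot 1 (direction `iηE`) and slot 3 (direction `−iηE`)
  have n2 : (⟨x.shift μ, ν⟩ : PBond P j) ≠ ⟨x, μ⟩ := fun e => hμν.symm (by simp only [PBond.mk.injEq] at e; exact e.2)
  have n3 : (⟨x.shift ν, μ⟩ : PBond P j) ≠ ⟨x, μ⟩ := fun e => shift_ne_self x ν (by simp only [PBond.mk.injEq] at e; exact e.1)
  have n4 : (⟨x, ν⟩ : PBond P j) ≠ ⟨x, μ⟩ := fun e => hμν.symm (by simp only [PBond.mk.injEq] at e; exact e.2)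
  have m1 : (⟨x.unshift ν, μ⟩ : PBond P j) ≠ ⟨x, μ⟩ := fun e => unshift_ne_self x ν (by simp only [PBond.mk.injEq] at e; exact e.1)
  have m2 : (⟨(x.unshift ν).shift μ, ν⟩ : PBond P j) ≠ ⟨x, μ⟩ := fun e => hμν.symm (by simp only [PBond.mk.injEq] at e; exact e.2)
  have m4 : (⟨x.unshift ν, ν⟩ : PBond P j) ≠ ⟨x, μ⟩ := fun e => hμν.symm (by simp only [PBond.mk.injEq] at e; exact e.2)
  have F1 : (fun t : ℂ => (1 - (2 : ℂ)⁻¹ * Matrix.trace (exp (((Complex.I * (η : ℂ)) • A ⟨(⟨x, μ, ν, h⟩ : Plaq P j).src, (⟨x, μ, ν, h⟩ : Plaq P j).μ⟩) + t • ((Complex.I * (η : ℂ)) • (Pi.single (⟨x, μ⟩ : PBond P j) E : PBond P j → Matrix (Fin 2) (Fin 2) ℂ) ⟨(⟨x, μ, ν, h⟩ : Plaq P j).src, (⟨x, μ, ν, h⟩ : Plaq P j).μ⟩)) * exp (((Complex.I * (η : ℂ)) • A ⟨(⟨x, μ, ν, h⟩ : Plaq P j).src.shift (⟨x, μ, ν,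 h⟩ : Plaq P j).μ, (⟨x, μ, ν, h⟩ : Plaq P j).ν⟩) + t • ((Complex.I * (η : ℂ)) • (Pi.single (⟨x, μ⟩ : PBond P j) E : PBond P j → Matrix (Fin 2) (Fin 2) ℂ) ⟨(⟨x, μ, ν, h⟩ : Plaq P j).src.shift (⟨x, μ, ν, h⟩ : Plaq P j).μ, (⟨x, μ, ν, h⟩ : Plaq P j).ν⟩)) * exp ((-((Complex.I * (η : ℂ)) • A ⟨(⟨x, μ, ν, h⟩ : Plaq P j).src.shift (⟨x, μ, ν, h⟩ : Plaq P j).ν, (⟨x, μ, ν, h⟩ : Plaq P j).μ⟩)) + t • (-((Complex.I * (η : ℂ)) • (Pi.single (⟨x, μ⟩ : PBond P j) E : PBond P j → Matrix (Fin 2) (Fin 2) ℂ) ⟨(⟨x, μ, ν, h⟩ : Plaq P j).src.shift (⟨x, μ, ν, h⟩ : Plaq P j).ν, (⟨x, μ, ν, h⟩ : Plaq P j).μ⟩))) * exp ((-((Complex.I * (η : ℂ)) • A ⟨(⟨x, μ, ν, h⟩ : Plaq P j).src, (⟨x, μ, ν, h⟩ : Plaq P j).ν⟩)) + t • (-((Complex.I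 * (η : ℂ)) • (Pi.single (⟨x, μ⟩ : PBond P j) E : PBond P j → Matrix (Fin 2) (Fin 2) ℂ) ⟨(⟨x, μ, ν, h⟩ : Plaq P j).src, (⟨x, μ, ν, h⟩ : Plaq P j).ν⟩)))) + (2 : ℂ)⁻¹ * Matrix.trace ((((Complex.I * (η : ℂ)) • A ⟨(⟨x, μ, ν, h⟩ : Plaq P j).src, (⟨x, μ, ν, h⟩ : Plaq P j).μ⟩) + t • ((Complex.I * (η : ℂ)) • (Pi.single (⟨x, μ⟩ : PBond P j) E : PBond P j → Matrix (Fin 2) (Fin 2) ℂ) ⟨(⟨x, μ, ν, h⟩ : Plaq P j).src, (⟨x, μ, ν, h⟩ : Plaq P j).μ⟩)) + (((Complex.I * (η : ℂ)) • A ⟨(⟨x, μ, ν, h⟩ : Plaq P j).src.shift (⟨x, μ, ν, h⟩ : Plaq P j).μ, (⟨x, μ, ν, h⟩ : Plaq P j).ν⟩) + t • ((Complex.I * (η : ℂ)) • (Pi.single (⟨x, μ⟩ : PBond P j) E : PBond P j → Matrix (Fin 2) (Fin 2) ℂ) ⟨(⟨x, μ, ν, h⟩ : Plaq P j).src.shift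 (⟨x, μ, ν, h⟩ : Plaq P j).μ, (⟨x, μ, ν, h⟩ : Plaq P j).ν⟩)) + ((-((Complex.I * (η : ℂ)) • A ⟨(⟨x, μ, ν, h⟩ : Plaq P j).src.shift (⟨x, μ, ν, h⟩ : Plaq P j).ν, (⟨x, μ, ν, h⟩ : Plaq P j).μ⟩)) + t • (-((Complex.I * (η : ℂ)) • (Pi.single (⟨x, μ⟩ : PBond P j) E : PBond P j → Matrix (Fin 2) (Fin 2) ℂ) ⟨(⟨x, μ, ν, h⟩ : Plaq P j).src.shift (⟨x, μ, ν, h⟩ : Plaq P j).ν, (⟨x, μ, ν, h⟩ : Plaq P j).μ⟩))) + ((-((Complex.I * (η : ℂ)) • A ⟨(⟨x, μ, ν, h⟩ : Plaq P j).src, (⟨x, μ, ν, h⟩ : Plaq P j).ν⟩)) + t • (-((Complex.I * (η : ℂ)) • (Pi.single (⟨x, μ⟩ : PBond P j) E : PBond P j → Matrix (Fin 2) (Fin 2) ℂ) ⟨(⟨x, μ, ν, h⟩ : Plaq P j).src, (⟨x, μ, ν, h⟩ : Plaq P j).ν⟩)))) + (4 : ℂ)⁻¹ * Matrix.trace (((((Complex.I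 * (η : ℂ)) • A ⟨(⟨x, μ, ν, h⟩ : Plaq P j).src, (⟨x, μ, ν, h⟩ : Plaq P j).μ⟩) + t • ((Complex.I * (η : ℂ)) • (Pi.single (⟨x, μ⟩ : PBond P j) E : PBond P j → Matrix (Fin 2) (Fin 2) ℂ) ⟨(⟨x, μ, ν, h⟩ : Plaq P j).src, (⟨x, μ, ν, h⟩ : Plaq P j).μ⟩)) + (((Complex.I * (η : ℂ)) • A ⟨(⟨x, μ, ν, h⟩ : Plaq P j).src.shift (⟨x, μ, ν, h⟩ : Plaq P j).μ, (⟨x, μ, ν, h⟩ : Plaq P j).ν⟩) + t • ((Complex.I * (η : ℂ)) • (Pi.single (⟨x, μ⟩ : PBond P j) E : PBond P j → Matrix (Fin 2) (Fin 2) ℂ) ⟨(⟨x, μ, ν, h⟩ : Plaq P j).src.shift (⟨x, μ, ν, h⟩ : Plaq P j).μ, (⟨x, μ, ν, h⟩ : Plaq P j).ν⟩)) + ((-((Complex.I * (η : ℂ)) • A ⟨(⟨x, μ, ν, h⟩ : Plaq P j).src.shift (⟨x, μ, ν, h⟩ : Plaq P j).ν, (⟨x, μ, ν, h⟩ : Plaq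 P j).μ⟩)) + t • (-((Complex.I * (η : ℂ)) • (Pi.single (⟨x, μ⟩ : PBond P j) E : PBond P j → Matrix (Fin 2) (Fin 2) ℂ) ⟨(⟨x, μ, ν, h⟩ : Plaq P j).src.shift (⟨x, μ, ν, h⟩ : Plaq P j).ν, (⟨x, μ, ν, h⟩ : Plaq P j).μ⟩))) + ((-((Complex.I * (η : ℂ)) • A ⟨(⟨x, μ, ν, h⟩ : Plaq P j).src, (⟨x, μ, ν, h⟩ : Plaq P j).ν⟩)) + t • (-((Complex.I * (η : ℂ)) • (Pi.single (⟨x, μ⟩ : PBond P j) E : PBond P j → Matrix (Fin 2) (Fin 2) ℂ) ⟨(⟨x, μ, ν, h⟩ : Plaq P j).src, (⟨x, μ, ν, h⟩ : Plaq P j).ν⟩)))) ^ 2))) =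
      fun t : ℂ => (1 - (2 : ℂ)⁻¹ * Matrix.trace (exp (((Complex.I * (η : ℂ)) • A ⟨x, μ⟩) + t • ((Complex.I * (η : ℂ)) • E)) * exp ((Complex.I * (η : ℂ)) • A ⟨x.shift μ, ν⟩) * exp (-((Complex.I * (η : ℂ)) • A ⟨x.shift ν, μ⟩)) * exp (-((Complex.I * (η : ℂ)) • A ⟨x, ν⟩))) + (2 : ℂ)⁻¹ * Matrix.trace ((((Complex.I * (η : ℂ)) • A ⟨x, μ⟩) + t • ((Complex.I * (η : ℂ)) • E)) + ((Complex.I * (η : ℂ)) • A ⟨x.shift μ, ν⟩) + (-((Complex.I * (η : ℂ)) • A ⟨x.shift ν, μ⟩)) + (-((Complex.I * (η : ℂ)) • A ⟨x, ν⟩))) + (4 : ℂ)⁻¹ * Matrix.trace (((((Complex.I * (η : ℂ)) • A ⟨x, μ⟩) + t • ((Complex.I * (η : ℂ)) • E)) + ((Complex.I * (η : ℂ)) • A ⟨x.shift μ, ν⟩) + (-((Complex.I * (η : ℂ)) • A ⟨x.shift ν, μ⟩)) + (-((Complex.I * (η : ℂ)) • A ⟨x, ν⟩))) ^ 2)) :=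 by
    funext t
    simp only [Pi.single_eq_same, Pi.single_apply, if_neg n2, if_neg n3, if_neg n4, smul_zero, neg_zero, add_zero]
  have F3 : (fun t : ℂ => (1 - (2 : ℂ)⁻¹ * Matrix.trace (exp (((Complex.I * (η : ℂ)) • A ⟨(⟨x.unshift ν, μ, ν, h⟩ : Plaq P j).src, (⟨x.unshift ν, μ, ν, h⟩ : Plaq P j).μ⟩) + t • ((Complex.I * (η : ℂ)) • (Pi.single (⟨x, μ⟩ : PBond P j) E : PBond P j → Matrix (Fin 2) (Fin 2) ℂ) ⟨(⟨x.unshift ν, μ, ν, h⟩ : Plaq P j).src, (⟨x.unshift ν, μ, ν, h⟩ : Plaq P j).μ⟩)) * exp (((Complex.I * (η : ℂ)) • A ⟨(⟨x.unshift ν, μ, ν, h⟩ : Plaq P j).src.shift (⟨x.unshift ν, μ, ν, h⟩ : Plaq P j).μ, (⟨x.unshift ν, μ, ν, h⟩ : Plaq P j).ν⟩) + t • ((Complex.I * (η : ℂ)) • (Pi.single (⟨x, μ⟩ : PBond P j) E : PBond P j → Matrix (Fin 2) (Fin 2) ℂ) ⟨(⟨x.unshift ν, μ, ν, h⟩ :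 Plaq P j).src.shift (⟨x.unshift ν, μ, ν, h⟩ : Plaq P j).μ, (⟨x.unshift ν, μ, ν, h⟩ : Plaq P j).ν⟩)) * exp ((-((Complex.I * (η : ℂ)) • A ⟨(⟨x.unshift ν, μ, ν, h⟩ : Plaq P j).src.shift (⟨x.unshift ν, μ, ν, h⟩ : Plaq P j).ν, (⟨x.unshift ν, μ, ν, h⟩ : Plaq P j).μ⟩)) + t • (-((Complex.I * (η : ℂ)) • (Pi.single (⟨x, μ⟩ : PBond P j) E : PBond P j → Matrix (Fin 2) (Fin 2) ℂ) ⟨(⟨x.unshift ν, μ, ν, h⟩ : Plaq P j).src.shift (⟨x.unshift ν, μ, ν, h⟩ : Plaq P j).ν, (⟨x.unshift ν, μ, ν, h⟩ : Plaq P j).μ⟩))) * exp ((-((Complex.I * (η : ℂ)) • A ⟨(⟨x.unshift ν, μ, ν, h⟩ : Plaq P j).src, (⟨x.unshift ν, μ, ν, h⟩ : Plaq P j).ν⟩)) + t • (-((Complex.I * (η : ℂ)) • (Pi.single (⟨x, μ⟩ : PBond P j) E : PBond P j → Matrix (Fin 2) (Fin 2) ℂ) ⟨(⟨x.unshift ν,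 μ, ν, h⟩ : Plaq P j).src, (⟨x.unshift ν, μ, ν, h⟩ : Plaq P j).ν⟩)))) + (2 : ℂ)⁻¹ * Matrix.trace ((((Complex.I * (η : ℂ)) • A ⟨(⟨x.unshift ν, μ, ν, h⟩ : Plaq P j).src, (⟨x.unshift ν, μ, ν, h⟩ : Plaq P j).μ⟩) + t • ((Complex.I * (η : ℂ)) • (Pi.single (⟨x, μ⟩ : PBond P j) E : PBond P j → Matrix (Fin 2) (Fin 2) ℂ) ⟨(⟨x.unshift ν, μ, ν, h⟩ : Plaq P j).src, (⟨x.unshift ν, μ, ν, h⟩ : Plaq P j).μ⟩)) + (((Complex.I * (η : ℂ)) • A ⟨(⟨x.unshift ν, μ, ν, h⟩ : Plaq P j).src.shift (⟨x.unshift ν, μ, ν, h⟩ : Plaq P j).μ, (⟨x.unshift ν, μ, ν, h⟩ : Plaq P j).ν⟩) + t • ((Complex.I * (η : ℂ)) • (Pi.single (⟨x, μ⟩ : PBond P j) E : PBond P j → Matrix (Fin 2) (Fin 2) ℂ) ⟨(⟨x.unshift ν, μ, ν, h⟩ : Plaq P j).src.shift (⟨x.unshift ν, μ, ν, h⟩ :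 Plaq P j).μ, (⟨x.unshift ν, μ, ν, h⟩ : Plaq P j).ν⟩)) + ((-((Complex.I * (η : ℂ)) • A ⟨(⟨x.unshift ν, μ, ν, h⟩ : Plaq P j).src.shift (⟨x.unshift ν, μ, ν, h⟩ : Plaq P j).ν, (⟨x.unshift ν, μ, ν, h⟩ : Plaq P j).μ⟩)) + t • (-((Complex.I * (η : ℂ)) • (Pi.single (⟨x, μ⟩ : PBond P j) E : PBond P j → Matrix (Fin 2) (Fin 2) ℂ) ⟨(⟨x.unshift ν, μ, ν, h⟩ : Plaq P j).src.shift (⟨x.unshift ν, μ, ν, h⟩ : Plaq P j).ν, (⟨x.unshift ν, μ, ν, h⟩ : Plaq P j).μ⟩))) + ((-((Complex.I * (η : ℂ)) • A ⟨(⟨x.unshift ν, μ, ν, h⟩ : Plaq P j).src, (⟨x.unshift ν, μ, ν, h⟩ : Plaq P j).ν⟩)) + t • (-((Complex.I * (η : ℂ)) • (Pi.single (⟨x, μ⟩ : PBond P j) E : PBond P j → Matrix (Fin 2) (Fin 2) ℂ) ⟨(⟨x.unshift ν, μ, ν, h⟩ : Plaq P j).src, (⟨x.unshift ν, μ, ν,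 h⟩ : Plaq P j).ν⟩)))) + (4 : ℂ)⁻¹ * Matrix.trace (((((Complex.I * (η : ℂ)) • A ⟨(⟨x.unshift ν, μ, ν, h⟩ : Plaq P j).src, (⟨x.unshift ν, μ, ν, h⟩ : Plaq P j).μ⟩) + t • ((Complex.I * (η : ℂ)) • (Pi.single (⟨x, μ⟩ : PBond P j) E : PBond P j → Matrix (Fin 2) (Fin 2) ℂ) ⟨(⟨x.unshift ν, μ, ν, h⟩ : Plaq P j).src, (⟨x.unshift ν, μ, ν, h⟩ : Plaq P j).μ⟩)) + (((Complex.I * (η : ℂ)) • A ⟨(⟨x.unshift ν, μ, ν, h⟩ : Plaq P j).src.shift (⟨x.unshift ν, μ, ν, h⟩ : Plaq P j).μ, (⟨x.unshift ν, μ, ν, h⟩ : Plaq P j).ν⟩) + t • ((Complex.I * (η : ℂ)) • (Pi.single (⟨x, μ⟩ : PBond P j) E : PBond P j → Matrix (Fin 2) (Fin 2) ℂ) ⟨(⟨x.unshift ν, μ, ν, h⟩ : Plaq P j).src.shift (⟨x.unshift ν, μ, ν, h⟩ : Plaq P j).μ, (⟨x.unshift ν, μ, ν, h⟩ : Plaq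 P j).ν⟩)) + ((-((Complex.I * (η : ℂ)) • A ⟨(⟨x.unshift ν, μ, ν, h⟩ : Plaq P j).src.shift (⟨x.unshift ν, μ, ν, h⟩ : Plaq P j).ν, (⟨x.unshift ν, μ, ν, h⟩ : Plaq P j).μ⟩)) + t • (-((Complex.I * (η : ℂ)) • (Pi.single (⟨x, μ⟩ : PBond P j) E : PBond P j → Matrix (Fin 2) (Fin 2) ℂ) ⟨(⟨x.unshift ν, μ, ν, h⟩ : Plaq P j).src.shift (⟨x.unshift ν, μ, ν, h⟩ : Plaq P j).ν, (⟨x.unshift ν, μ, ν, h⟩ : Plaq P j).μ⟩))) + ((-((Complex.I * (η : ℂ)) • A ⟨(⟨x.unshift ν, μ, ν, h⟩ : Plaq P j).src, (⟨x.unshift ν, μ, ν, h⟩ : Plaq P j).ν⟩)) + t • (-((Complex.I * (η : ℂ)) • (Pi.single (⟨x, μ⟩ : PBond P j) E : PBond P j → Matrix (Fin 2) (Fin 2) ℂ) ⟨(⟨x.unshift ν, μ, ν, h⟩ : Plaq P j).src, (⟨x.unshift ν, μ, ν, h⟩ : Plaq P j).ν⟩)))) ^ 2))) =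
      fun t : ℂ => (1 - (2 : ℂ)⁻¹ * Matrix.trace (exp ((Complex.I * (η : ℂ)) • A ⟨x.unshift ν, μ⟩) * exp ((Complex.I * (η : ℂ)) • A ⟨(x.unshift ν).shift μ, ν⟩) * exp ((-((Complex.I * (η : ℂ)) • A ⟨x, μ⟩)) + t • (-((Complex.I * (η : ℂ)) • E))) * exp (-((Complex.I * (η : ℂ)) • A ⟨x.unshift ν, ν⟩))) + (2 : ℂ)⁻¹ * Matrix.trace (((Complex.I * (η : ℂ)) • A ⟨x.unshift ν, μ⟩) + ((Complex.I * (η : ℂ)) • A ⟨(x.unshift ν).shift μ, ν⟩) + ((-((Complex.I * (η : ℂ)) • A ⟨x, μ⟩)) + t • (-((Complex.I * (η : ℂ)) • E))) + (-((Complex.I * (η : ℂ)) • A ⟨x.unshift ν, ν⟩))) + (4 : ℂ)⁻¹ * Matrix.trace ((((Complex.I * (η : ℂ)) • A ⟨x.unshift ν, μ⟩) + ((Complex.I * (η : ℂ)) • A ⟨(x.unshift ν).shift μ, ν⟩) + ((-((Complex.I * (η : ℂ)) • A ⟨x, μ⟩)) + t • (-((Complex.I * (η : ℂ)) • E))) +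 (-((Complex.I * (η : ℂ)) • A ⟨x.unshift ν, ν⟩))) ^ 2)) := by
    funext t
    simp only [Site.shift_unshift, Pi.single_eq_same, Pi.single_apply, if_neg m1, if_neg m2, if_neg m4, smul_zero, neg_zero, add_zero, smul_neg]
  rw [F1, F3]
  -- the sixteen letters of the pair lemma
  have nc : ∀ X : Matrix (Fin 2) (Fin 2) ℂ, ‖(Complex.I * (η : ℂ)) • X‖ = η * ‖X‖ := norm_cI_smul hη
  have hH : ‖((Complex.I * (η : ℂ)) • E)‖ ≤ η := by rw [nc]; exact (mul_le_mul_of_nonneg_left hE hη.le).trans (by rw [mul_one])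
  have hm0 : 0 ≤ η * r := by positivity
  have bY : ∀ b' : PBond P j, ‖(Complex.I * (η : ℂ)) • A b'‖ ≤ η * r := fun b' => by rw [nc]; exact mul_le_mul_of_nonneg_left (hA b') hη.le
  have bYn : ∀ b' : PBond P j, ‖-((Complex.I * (η : ℂ)) • A b')‖ ≤ η * r := fun b' => by rw [norm_neg]; exact bY b'
  have dd : ∀ b₁ b₂ : PBond P j, ‖A b₁ - A b₂‖ ≤ η * r →
      ‖(Complex.I * (η : ℂ)) • A b₁ - (Complex.I * (η : ℂ)) • A b₂‖ ≤ η * (η * r) := fun b₁ b₂ hb => by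
    rw [← smul_sub, nc]; exact mul_le_mul_of_nonneg_left hb hη.le
  have ddn : ∀ b₁ b₂ : PBond P j, ‖A b₁ - A b₂‖ ≤ η * r →
      ‖-((Complex.I * (η : ℂ)) • A b₁) - -((Complex.I * (η : ℂ)) • A b₂)‖ ≤ η * (η * r) := fun b₁ b₂ hb => by
    rw [neg_sub_neg, ← smul_sub, nc, norm_sub_rev]; exact mul_le_mul_of_nonneg_left hb hη.le
  have dpn : ∀ b₁ b₂ : PBond P j, ‖A b₁ - A b₂‖ ≤ η * r →
      ‖(Complex.I * (η : ℂ)) • A b₁ + -((Complex.I * (η : ℂ)) • A b₂)‖ ≤ η * (η * r) := fun b₁ b₂ hb => by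
    rw [← sub_eq_add_neg, ← smul_sub, nc]; exact mul_le_mul_of_nonneg_left hb hη.le
  have e2 : ((x.unshift ν).shift μ).shift ν = x.shift μ := by rw [unshift_shift_comm, Site.shift_unshift]
  have d1 := dd ⟨x, μ⟩ ⟨x.unshift ν, μ⟩ (by simpa only [Site.shift_unshift] using hD' (x.unshift ν) μ ν)
  have d2 := dd ⟨x.shift μ, ν⟩ ⟨(x.unshift ν).shift μ, ν⟩ (by simpa only [e2] using hD' ((x.unshift ν).shift μ) ν ν)
  have d3 := ddn ⟨x.shift ν, μ⟩ ⟨x, μ⟩ (hD' x μ ν)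
  have d4 := ddn ⟨x, ν⟩ ⟨x.unshift ν, ν⟩ (by simpa only [Site.shift_unshift] using hD' (x.unshift ν) ν ν)
  have hS := dpn ⟨x, μ⟩ ⟨x.shift ν, μ⟩ (by rw [norm_sub_rev]; exact hD' x μ ν)
  have hT := dpn ⟨x.shift μ, ν⟩ ⟨x, ν⟩ (hD' x ν μ)
  have hm1 : η * r + r * ‖((Complex.I * (η : ℂ)) • E)‖ ≤ 1 := by nlinarith
  have key := norm_deriv_pair13_le ((Complex.I * (η : ℂ)) • A ⟨x, μ⟩) ((Complex.I * (η : ℂ)) • A ⟨x.shift μ, ν⟩) (-((Complex.I * (η : ℂ)) • A ⟨x.shift ν, μ⟩)) (-((Complex.I * (η : ℂ)) • A ⟨x, ν⟩)) ((Complex.I * (η : ℂ)) • A ⟨x.unshift ν, μ⟩) ((Complex.I * (η : ℂ)) • A ⟨(x.unshift ν).shift μ, ν⟩) (-((Complex.I * (η : ℂ)) • A ⟨x, μ⟩)) (-((Complex.I * (η : ℂ)) • A ⟨x.unshift ν, ν⟩)) ((Complex.I * (η : ℂ)) • E) hm0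
    (bY _) (bY _) (bYn _) (bYn _) (bY _) (bY _) (bYn _) (bYn _) d1 d2 d3 d4 hS hT hr hm1
  exact key.trans (pair_arith hη hη1 hr hr2 (norm_nonneg _) hH)

/-- **THE (4,2)-PAIR AT THE LATTICE**: for `b = ⟨x, μ⟩` and `ν < μ`, the plaquettes `p_{νμ}(x − e_ν)` (slot 2) and `p_{νμ}(x)` (slot 4) contribute together
at most `725η⁴r²`. [cite: Balaban1985Variational, (93)-(96) p.292] -/
theorem norm_pair42_le (hη : 0 < η) (hη1 : η ≤ 1) {r : ℝ} (hr : 0 < r) (hr2 : r ≤ 1 / 2) (A : PBond P j → Matrix (Fin 2) (Fin 2) ℂ)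
    (hA : ∀ b, ‖A b‖ ≤ r) (hD : ∀ (s : Site P j) (μ ν : Fin P.d), η⁻¹ * ‖A ⟨s.shift ν, μ⟩ - A ⟨s, μ⟩‖ ≤ r)
    (E : Matrix (Fin 2) (Fin 2) ℂ) (hE : ‖E‖ ≤ 1) (b : PBond P j) (ν : Fin P.d) (h : ν < b.dir) :
    ‖deriv (fun t : ℂ => (1 - (2 : ℂ)⁻¹ * Matrix.trace (exp (((Complex.I * (η : ℂ)) • A ⟨(⟨b.src.unshift ν, ν, b.dir, h⟩ : Plaq P j).src, (⟨b.src.unshift ν, ν, b.dir, h⟩ : Plaq P j).μ⟩) + t • ((Complex.I * (η : ℂ)) • (Pi.single b E : PBond P j → Matrix (Fin 2) (Fin 2) ℂ) ⟨(⟨b.src.unshift ν, ν, b.dir, h⟩ : Plaq P j).src, (⟨b.src.unshift ν, ν, b.dir, h⟩ : Plaq P j).μ⟩)) * exp (((Complex.I * (η : ℂ)) • A ⟨(⟨b.src.unshift ν, ν, b.dir, h⟩ : Plaq P j).src.shift (⟨b.src.unshift ν, ν, b.dir, h⟩ : Plaq P j).μ, (⟨b.src.unshift ν, ν, b.dir,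 h⟩ : Plaq P j).ν⟩) + t • ((Complex.I * (η : ℂ)) • (Pi.single b E : PBond P j → Matrix (Fin 2) (Fin 2) ℂ) ⟨(⟨b.src.unshift ν, ν, b.dir, h⟩ : Plaq P j).src.shift (⟨b.src.unshift ν, ν, b.dir, h⟩ : Plaq P j).μ, (⟨b.src.unshift ν, ν, b.dir, h⟩ : Plaq P j).ν⟩)) * exp ((-((Complex.I * (η : ℂ)) • A ⟨(⟨b.src.unshift ν, ν, b.dir, h⟩ : Plaq P j).src.shift (⟨b.src.unshift ν, ν, b.dir, h⟩ : Plaq P j).ν, (⟨b.src.unshift ν, ν, b.dir, h⟩ : Plaq P j).μ⟩)) + t • (-((Complex.I * (η : ℂ)) • (Pi.single b E : PBond P j → Matrix (Fin 2) (Fin 2) ℂ) ⟨(⟨b.src.unshift ν, ν, b.dir, h⟩ : Plaq P j).src.shift (⟨b.src.unshift ν, ν, b.dir, h⟩ : Plaq P j).ν, (⟨b.src.unshift ν, ν, b.dir, h⟩ : Plaq P j).μ⟩))) * exp ((-((Complex.I * (η : ℂ)) • A ⟨(⟨b.src.unshift ν, ν, b.dir, h⟩ : Plaq P j).src, (⟨b.src.unshift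 ν, ν, b.dir, h⟩ : Plaq P j).ν⟩)) + t • (-((Complex.I * (η : ℂ)) • (Pi.single b E : PBond P j → Matrix (Fin 2) (Fin 2) ℂ) ⟨(⟨b.src.unshift ν, ν, b.dir, h⟩ : Plaq P j).src, (⟨b.src.unshift ν, ν, b.dir, h⟩ : Plaq P j).ν⟩)))) + (2 : ℂ)⁻¹ * Matrix.trace ((((Complex.I * (η : ℂ)) • A ⟨(⟨b.src.unshift ν, ν, b.dir, h⟩ : Plaq P j).src, (⟨b.src.unshift ν, ν, b.dir, h⟩ : Plaq P j).μ⟩) + t • ((Complex.I * (η : ℂ)) • (Pi.single b E : PBond P j → Matrix (Fin 2) (Fin 2) ℂ) ⟨(⟨b.src.unshift ν, ν, b.dir, h⟩ : Plaq P j).src, (⟨b.src.unshift ν, ν, b.dir, h⟩ : Plaq P j).μ⟩)) + (((Complex.I * (η : ℂ)) • A ⟨(⟨b.src.unshift ν, ν, b.dir, h⟩ : Plaq P j).src.shift (⟨b.src.unshift ν, ν, b.dir, h⟩ : Plaq P j).μ, (⟨b.src.unshift ν, ν, b.dir, h⟩ : Plaq P j).ν⟩) + t • ((Complex.I * (η :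 ℂ)) • (Pi.single b E : PBond P j → Matrix (Fin 2) (Fin 2) ℂ) ⟨(⟨b.src.unshift ν, ν, b.dir, h⟩ : Plaq P j).src.shift (⟨b.src.unshift ν, ν, b.dir, h⟩ : Plaq P j).μ, (⟨b.src.unshift ν, ν, b.dir, h⟩ : Plaq P j).ν⟩)) + ((-((Complex.I * (η : ℂ)) • A ⟨(⟨b.src.unshift ν, ν, b.dir, h⟩ : Plaq P j).src.shift (⟨b.src.unshift ν, ν, b.dir, h⟩ : Plaq P j).ν, (⟨b.src.unshift ν, ν, b.dir, h⟩ : Plaq P j).μ⟩)) + t • (-((Complex.I * (η : ℂ)) • (Pi.single b E : PBond P j → Matrix (Fin 2) (Fin 2) ℂ) ⟨(⟨b.src.unshift ν, ν, b.dir, h⟩ : Plaq P j).src.shift (⟨b.src.unshift ν, ν, b.dir, h⟩ : Plaq P j).ν, (⟨b.src.unshift ν, ν, b.dir, h⟩ : Plaq P j).μ⟩))) + ((-((Complex.I * (η : ℂ)) • A ⟨(⟨b.src.unshift ν, ν, b.dir, h⟩ : Plaq P j).src, (⟨b.src.unshift ν, ν, b.dir, h⟩ : Plaq P j).ν⟩))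 + t • (-((Complex.I * (η : ℂ)) • (Pi.single b E : PBond P j → Matrix (Fin 2) (Fin 2) ℂ) ⟨(⟨b.src.unshift ν, ν, b.dir, h⟩ : Plaq P j).src, (⟨b.src.unshift ν, ν, b.dir, h⟩ : Plaq P j).ν⟩)))) + (4 : ℂ)⁻¹ * Matrix.trace (((((Complex.I * (η : ℂ)) • A ⟨(⟨b.src.unshift ν, ν, b.dir, h⟩ : Plaq P j).src, (⟨b.src.unshift ν, ν, b.dir, h⟩ : Plaq P j).μ⟩) + t • ((Complex.I * (η : ℂ)) • (Pi.single b E : PBond P j → Matrix (Fin 2) (Fin 2) ℂ) ⟨(⟨b.src.unshift ν, ν, b.dir, h⟩ : Plaq P j).src, (⟨b.src.unshift ν, ν, b.dir, h⟩ : Plaq P j).μ⟩)) + (((Complex.I * (η : ℂ)) • A ⟨(⟨b.src.unshift ν, ν, b.dir, h⟩ : Plaq P j).src.shift (⟨b.src.unshift ν, ν, b.dir, h⟩ : Plaq P j).μ, (⟨b.src.unshift ν, ν, b.dir, h⟩ : Plaq P j).ν⟩) + t • ((Complex.I * (η : ℂ)) • (Pi.single b E : PBond P j → Matrix (Fin 2)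 (Fin 2) ℂ) ⟨(⟨b.src.unshift ν, ν, b.dir, h⟩ : Plaq P j).src.shift (⟨b.src.unshift ν, ν, b.dir, h⟩ : Plaq P j).μ, (⟨b.src.unshift ν, ν, b.dir, h⟩ : Plaq P j).ν⟩)) + ((-((Complex.I * (η : ℂ)) • A ⟨(⟨b.src.unshift ν, ν, b.dir, h⟩ : Plaq P j).src.shift (⟨b.src.unshift ν, ν, b.dir, h⟩ : Plaq P j).ν, (⟨b.src.unshift ν, ν, b.dir, h⟩ : Plaq P j).μ⟩)) + t • (-((Complex.I * (η : ℂ)) • (Pi.single b E : PBond P j → Matrix (Fin 2) (Fin 2) ℂ) ⟨(⟨b.src.unshift ν, ν, b.dir, h⟩ : Plaq P j).src.shift (⟨b.src.unshift ν, ν, b.dir, h⟩ : Plaq P j).ν, (⟨b.src.unshift ν, ν, b.dir, h⟩ : Plaq P j).μ⟩))) + ((-((Complex.I * (η : ℂ)) • A ⟨(⟨b.src.unshift ν, ν, b.dir, h⟩ : Plaq P j).src, (⟨b.src.unshift ν, ν, b.dir, h⟩ : Plaq P j).ν⟩)) + t • (-((Complex.I * (η : ℂ)) • (Pi.single b E :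 PBond P j → Matrix (Fin 2) (Fin 2) ℂ) ⟨(⟨b.src.unshift ν, ν, b.dir, h⟩ : Plaq P j).src, (⟨b.src.unshift ν, ν, b.dir, h⟩ : Plaq P j).ν⟩)))) ^ 2))) 0 + deriv (fun t : ℂ => (1 - (2 : ℂ)⁻¹ * Matrix.trace (exp (((Complex.I * (η : ℂ)) • A ⟨(⟨b.src, ν, b.dir, h⟩ : Plaq P j).src, (⟨b.src, ν, b.dir, h⟩ : Plaq P j).μ⟩) + t • ((Complex.I * (η : ℂ)) • (Pi.single b E : PBond P j → Matrix (Fin 2) (Fin 2) ℂ) ⟨(⟨b.src, ν, b.dir, h⟩ : Plaq P j).src, (⟨b.src, ν, b.dir, h⟩ : Plaq P j).μ⟩)) * exp (((Complex.I * (η : ℂ)) • A ⟨(⟨b.src, ν, b.dir, h⟩ : Plaq P j).src.shift (⟨b.src, ν, b.dir, h⟩ : Plaq P j).μ, (⟨b.src, ν, b.dir, h⟩ : Plaq P j).ν⟩) + t • ((Complex.I * (η : ℂ)) • (Pi.single b E : PBond P j → Matrix (Fin 2) (Fin 2) ℂ) ⟨(⟨b.src, ν, b.dir, h⟩ : Plaq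 P j).src.shift (⟨b.src, ν, b.dir, h⟩ : Plaq P j).μ, (⟨b.src, ν, b.dir, h⟩ : Plaq P j).ν⟩)) * exp ((-((Complex.I * (η : ℂ)) • A ⟨(⟨b.src, ν, b.dir, h⟩ : Plaq P j).src.shift (⟨b.src, ν, b.dir, h⟩ : Plaq P j).ν, (⟨b.src, ν, b.dir, h⟩ : Plaq P j).μ⟩)) + t • (-((Complex.I * (η : ℂ)) • (Pi.single b E : PBond P j → Matrix (Fin 2) (Fin 2) ℂ) ⟨(⟨b.src, ν, b.dir, h⟩ : Plaq P j).src.shift (⟨b.src, ν, b.dir, h⟩ : Plaq P j).ν, (⟨b.src, ν, b.dir, h⟩ : Plaq P j).μ⟩))) * exp ((-((Complex.I * (η : ℂ)) • A ⟨(⟨b.src, ν, b.dir, h⟩ : Plaq P j).src, (⟨b.src, ν, b.dir, h⟩ : Plaq P j).ν⟩)) + t • (-((Complex.I * (η : ℂ)) • (Pi.single b E : PBond P j → Matrix (Fin 2) (Fin 2) ℂ) ⟨(⟨b.src, ν, b.dir, h⟩ : Plaq P j).src, (⟨b.src, ν, b.dir, h⟩ : Plaq P j).ν⟩)))) + (2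 : ℂ)⁻¹ * Matrix.trace ((((Complex.I * (η : ℂ)) • A ⟨(⟨b.src, ν, b.dir, h⟩ : Plaq P j).src, (⟨b.src, ν, b.dir, h⟩ : Plaq P j).μ⟩) + t • ((Complex.I * (η : ℂ)) • (Pi.single b E : PBond P j → Matrix (Fin 2) (Fin 2) ℂ) ⟨(⟨b.src, ν, b.dir, h⟩ : Plaq P j).src, (⟨b.src, ν, b.dir, h⟩ : Plaq P j).μ⟩)) + (((Complex.I * (η : ℂ)) • A ⟨(⟨b.src, ν, b.dir, h⟩ : Plaq P j).src.shift (⟨b.src, ν, b.dir, h⟩ : Plaq P j).μ, (⟨b.src, ν, b.dir, h⟩ : Plaq P j).ν⟩) + t • ((Complex.I * (η : ℂ)) • (Pi.single b E : PBond P j → Matrix (Fin 2) (Fin 2) ℂ) ⟨(⟨b.src, ν, b.dir, h⟩ : Plaq P j).src.shift (⟨b.src, ν, b.dir, h⟩ : Plaq P j).μ, (⟨b.src, ν, b.dir, h⟩ : Plaq P j).ν⟩)) + ((-((Complex.I * (η : ℂ)) • A ⟨(⟨b.src, ν, b.dir, h⟩ : Plaq P j).src.shift (⟨b.src, ν, b.dir,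 h⟩ : Plaq P j).ν, (⟨b.src, ν, b.dir, h⟩ : Plaq P j).μ⟩)) + t • (-((Complex.I * (η : ℂ)) • (Pi.single b E : PBond P j → Matrix (Fin 2) (Fin 2) ℂ) ⟨(⟨b.src, ν, b.dir, h⟩ : Plaq P j).src.shift (⟨b.src, ν, b.dir, h⟩ : Plaq P j).ν, (⟨b.src, ν, b.dir, h⟩ : Plaq P j).μ⟩))) + ((-((Complex.I * (η : ℂ)) • A ⟨(⟨b.src, ν, b.dir, h⟩ : Plaq P j).src, (⟨b.src, ν, b.dir, h⟩ : Plaq P j).ν⟩)) + t • (-((Complex.I * (η : ℂ)) • (Pi.single b E : PBond P j → Matrix (Fin 2) (Fin 2) ℂ) ⟨(⟨b.src, ν, b.dir, h⟩ : Plaq P j).src, (⟨b.src, ν, b.dir, h⟩ : Plaq P j).ν⟩)))) + (4 : ℂ)⁻¹ * Matrix.trace (((((Complex.I * (η : ℂ)) • A ⟨(⟨b.src, ν, b.dir, h⟩ : Plaq P j).src, (⟨b.src, ν, b.dir, h⟩ : Plaq P j).μ⟩) + t • ((Complex.I * (η : ℂ)) • (Pi.single b E : PBond P j → Matrix (Fin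 2) (Fin 2) ℂ) ⟨(⟨b.src, ν, b.dir, h⟩ : Plaq P j).src, (⟨b.src, ν, b.dir, h⟩ : Plaq P j).μ⟩)) + (((Complex.I * (η : ℂ)) • A ⟨(⟨b.src, ν, b.dir, h⟩ : Plaq P j).src.shift (⟨b.src, ν, b.dir, h⟩ : Plaq P j).μ, (⟨b.src, ν, b.dir, h⟩ : Plaq P j).ν⟩) + t • ((Complex.I * (η : ℂ)) • (Pi.single b E : PBond P j → Matrix (Fin 2) (Fin 2) ℂ) ⟨(⟨b.src, ν, b.dir, h⟩ : Plaq P j).src.shift (⟨b.src, ν, b.dir, h⟩ : Plaq P j).μ, (⟨b.src, ν, b.dir, h⟩ : Plaq P j).ν⟩)) + ((-((Complex.I * (η : ℂ)) • A ⟨(⟨b.src, ν, b.dir, h⟩ : Plaq P j).src.shift (⟨b.src, ν, b.dir, h⟩ : Plaq P j).ν, (⟨b.src, ν, b.dir, h⟩ : Plaq P j).μ⟩)) + t • (-((Complex.I * (η : ℂ)) • (Pi.single b E : PBond P j → Matrix (Fin 2) (Fin 2) ℂ) ⟨(⟨b.src, ν, b.dir, h⟩ : Plaq P j).src.shift (⟨b.src,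 ν, b.dir, h⟩ : Plaq P j).ν, (⟨b.src, ν, b.dir, h⟩ : Plaq P j).μ⟩))) + ((-((Complex.I * (η : ℂ)) • A ⟨(⟨b.src, ν, b.dir, h⟩ : Plaq P j).src, (⟨b.src, ν, b.dir, h⟩ : Plaq P j).ν⟩)) + t • (-((Complex.I * (η : ℂ)) • (Pi.single b E : PBond P j → Matrix (Fin 2) (Fin 2) ℂ) ⟨(⟨b.src, ν, b.dir, h⟩ : Plaq P j).src, (⟨b.src, ν, b.dir, h⟩ : Plaq P j).ν⟩)))) ^ 2))) 0‖ ≤ 725 * η ^ 4 * r ^ 2 := by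
  obtain ⟨x, μ⟩ := b
  have hμν : ν ≠ μ := ne_of_lt h
  have hD' : ∀ (s : Site P j) (μ' ν' : Fin P.d), ‖A ⟨s.shift ν', μ'⟩ - A ⟨s, μ'⟩‖ ≤ η * r := fun s μ' ν' =>
    (inv_mul_le_iff₀ hη).mp (hD s μ' ν')
  have n1 : (⟨x, ν⟩ : PBond P j) ≠ ⟨x, μ⟩ := fun e => hμν (by simp only [PBond.mk.injEq] at e; exact e.2)
  have n2 : (⟨x.shift ν, μ⟩ : PBond P j) ≠ ⟨x, μ⟩ := fun e => shift_ne_self x ν (by simp only [PBond.mk.injEq] at e; exact e.1)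
  have n3 : (⟨x.shift μ, ν⟩ : PBond P j) ≠ ⟨x, μ⟩ := fun e => hμν (by simp only [PBond.mk.injEq] at e; exact e.2)
  have m1 : (⟨x.unshift ν, ν⟩ : PBond P j) ≠ ⟨x, μ⟩ := fun e => hμν (by simp only [PBond.mk.injEq] at e; exact e.2)
  have m3 : (⟨(x.unshift ν).shift μ, ν⟩ : PBond P j) ≠ ⟨x, μ⟩ := fun e => hμν (by simp only [PBond.mk.injEq] at e; exact e.2)
  have m4 : (⟨x.unshift ν, μ⟩ : PBond P j) ≠ ⟨x, μ⟩ := fun e => unshift_ne_self x ν (by simp only [PBond.mk.injEq] at e; exact e.1)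
  have F2 : (fun t : ℂ => (1 - (2 : ℂ)⁻¹ * Matrix.trace (exp (((Complex.I * (η : ℂ)) • A ⟨(⟨x.unshift ν, ν, μ, h⟩ : Plaq P j).src, (⟨x.unshift ν, ν, μ, h⟩ : Plaq P j).μ⟩) + t • ((Complex.I * (η : ℂ)) • (Pi.single (⟨x, μ⟩ : PBond P j) E : PBond P j → Matrix (Fin 2) (Fin 2) ℂ) ⟨(⟨x.unshift ν, ν, μ, h⟩ : Plaq P j).src, (⟨x.unshift ν, ν, μ, h⟩ : Plaq P j).μ⟩)) * exp (((Complex.I * (η : ℂ)) • A ⟨(⟨x.unshift ν, ν, μ, h⟩ : Plaq P j).src.shift (⟨x.unshift ν, ν, μ, h⟩ : Plaq P j).μ, (⟨x.unshift ν, ν, μ, h⟩ : Plaq P j).ν⟩) + t • ((Complex.I * (η : ℂ)) • (Pi.single (⟨x, μ⟩ : PBond P j) E : PBond P j → Matrix (Fin 2) (Fin 2) ℂ) ⟨(⟨x.unshift ν, ν, μ, h⟩ : Plaq P j).src.shift (⟨x.unshift ν, ν, μ, h⟩ : Plaq P j).μ, (⟨x.unshift ν, ν, μ, h⟩ : Plaq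 P j).ν⟩)) * exp ((-((Complex.I * (η : ℂ)) • A ⟨(⟨x.unshift ν, ν, μ, h⟩ : Plaq P j).src.shift (⟨x.unshift ν, ν, μ, h⟩ : Plaq P j).ν, (⟨x.unshift ν, ν, μ, h⟩ : Plaq P j).μ⟩)) + t • (-((Complex.I * (η : ℂ)) • (Pi.single (⟨x, μ⟩ : PBond P j) E : PBond P j → Matrix (Fin 2) (Fin 2) ℂ) ⟨(⟨x.unshift ν, ν, μ, h⟩ : Plaq P j).src.shift (⟨x.unshift ν, ν, μ, h⟩ : Plaq P j).ν, (⟨x.unshift ν, ν, μ, h⟩ : Plaq P j).μ⟩))) * exp ((-((Complex.I * (η : ℂ)) • A ⟨(⟨x.unshift ν, ν, μ, h⟩ : Plaq P j).src, (⟨x.unshift ν, ν, μ, h⟩ : Plaq P j).ν⟩)) + t • (-((Complex.I * (η : ℂ)) • (Pi.single (⟨x, μ⟩ : PBond P j) E : PBond P j → Matrix (Fin 2) (Fin 2) ℂ) ⟨(⟨x.unshift ν, ν, μ, h⟩ : Plaq P j).src, (⟨x.unshift ν, ν, μ, h⟩ : Plaq P j).ν⟩)))) + (2 : ℂ)⁻¹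 * Matrix.trace ((((Complex.I * (η : ℂ)) • A ⟨(⟨x.unshift ν, ν, μ, h⟩ : Plaq P j).src, (⟨x.unshift ν, ν, μ, h⟩ : Plaq P j).μ⟩) + t • ((Complex.I * (η : ℂ)) • (Pi.single (⟨x, μ⟩ : PBond P j) E : PBond P j → Matrix (Fin 2) (Fin 2) ℂ) ⟨(⟨x.unshift ν, ν, μ, h⟩ : Plaq P j).src, (⟨x.unshift ν, ν, μ, h⟩ : Plaq P j).μ⟩)) + (((Complex.I * (η : ℂ)) • A ⟨(⟨x.unshift ν, ν, μ, h⟩ : Plaq P j).src.shift (⟨x.unshift ν, ν, μ, h⟩ : Plaq P j).μ, (⟨x.unshift ν, ν, μ, h⟩ : Plaq P j).ν⟩) + t • ((Complex.I * (η : ℂ)) • (Pi.single (⟨x, μ⟩ : PBond P j) E : PBond P j → Matrix (Fin 2) (Fin 2) ℂ) ⟨(⟨x.unshift ν, ν, μ, h⟩ : Plaq P j).src.shift (⟨x.unshift ν, ν, μ, h⟩ : Plaq P j).μ, (⟨x.unshift ν, ν, μ, h⟩ : Plaq P j).ν⟩)) + ((-((Complex.I * (η : ℂ)) • A ⟨(⟨x.unshift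 ν, ν, μ, h⟩ : Plaq P j).src.shift (⟨x.unshift ν, ν, μ, h⟩ : Plaq P j).ν, (⟨x.unshift ν, ν, μ, h⟩ : Plaq P j).μ⟩)) + t • (-((Complex.I * (η : ℂ)) • (Pi.single (⟨x, μ⟩ : PBond P j) E : PBond P j → Matrix (Fin 2) (Fin 2) ℂ) ⟨(⟨x.unshift ν, ν, μ, h⟩ : Plaq P j).src.shift (⟨x.unshift ν, ν, μ, h⟩ : Plaq P j).ν, (⟨x.unshift ν, ν, μ, h⟩ : Plaq P j).μ⟩))) + ((-((Complex.I * (η : ℂ)) • A ⟨(⟨x.unshift ν, ν, μ, h⟩ : Plaq P j).src, (⟨x.unshift ν, ν, μ, h⟩ : Plaq P j).ν⟩)) + t • (-((Complex.I * (η : ℂ)) • (Pi.single (⟨x, μ⟩ : PBond P j) E : PBond P j → Matrix (Fin 2) (Fin 2) ℂ) ⟨(⟨x.unshift ν, ν, μ, h⟩ : Plaq P j).src, (⟨x.unshift ν, ν, μ, h⟩ : Plaq P j).ν⟩)))) + (4 : ℂ)⁻¹ * Matrix.trace (((((Complex.I * (η : ℂ)) • A ⟨(⟨x.unshift ν, ν,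 μ, h⟩ : Plaq P j).src, (⟨x.unshift ν, ν, μ, h⟩ : Plaq P j).μ⟩) + t • ((Complex.I * (η : ℂ)) • (Pi.single (⟨x, μ⟩ : PBond P j) E : PBond P j → Matrix (Fin 2) (Fin 2) ℂ) ⟨(⟨x.unshift ν, ν, μ, h⟩ : Plaq P j).src, (⟨x.unshift ν, ν, μ, h⟩ : Plaq P j).μ⟩)) + (((Complex.I * (η : ℂ)) • A ⟨(⟨x.unshift ν, ν, μ, h⟩ : Plaq P j).src.shift (⟨x.unshift ν, ν, μ, h⟩ : Plaq P j).μ, (⟨x.unshift ν, ν, μ, h⟩ : Plaq P j).ν⟩) + t • ((Complex.I * (η : ℂ)) • (Pi.single (⟨x, μ⟩ : PBond P j) E : PBond P j → Matrix (Fin 2) (Fin 2) ℂ) ⟨(⟨x.unshift ν, ν, μ, h⟩ : Plaq P j).src.shift (⟨x.unshift ν, ν, μ, h⟩ : Plaq P j).μ, (⟨x.unshift ν, ν, μ, h⟩ : Plaq P j).ν⟩)) + ((-((Complex.I * (η : ℂ)) • A ⟨(⟨x.unshift ν, ν, μ, h⟩ : Plaq P j).src.shift (⟨x.unshift ν, ν,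 μ, h⟩ : Plaq P j).ν, (⟨x.unshift ν, ν, μ, h⟩ : Plaq P j).μ⟩)) + t • (-((Complex.I * (η : ℂ)) • (Pi.single (⟨x, μ⟩ : PBond P j) E : PBond P j → Matrix (Fin 2) (Fin 2) ℂ) ⟨(⟨x.unshift ν, ν, μ, h⟩ : Plaq P j).src.shift (⟨x.unshift ν, ν, μ, h⟩ : Plaq P j).ν, (⟨x.unshift ν, ν, μ, h⟩ : Plaq P j).μ⟩))) + ((-((Complex.I * (η : ℂ)) • A ⟨(⟨x.unshift ν, ν, μ, h⟩ : Plaq P j).src, (⟨x.unshift ν, ν, μ, h⟩ : Plaq P j).ν⟩)) + t • (-((Complex.I * (η : ℂ)) • (Pi.single (⟨x, μ⟩ : PBond P j) E : PBond P j → Matrix (Fin 2) (Fin 2) ℂ) ⟨(⟨x.unshift ν, ν, μ, h⟩ : Plaq P j).src, (⟨x.unshift ν, ν, μ, h⟩ : Plaq P j).ν⟩)))) ^ 2))) =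
      fun t : ℂ => (1 - (2 : ℂ)⁻¹ * Matrix.trace (exp ((Complex.I * (η : ℂ)) • A ⟨x.unshift ν, ν⟩) * exp (((Complex.I * (η : ℂ)) • A ⟨x, μ⟩) + t • ((Complex.I * (η : ℂ)) • E)) * exp (-((Complex.I * (η : ℂ)) • A ⟨(x.unshift ν).shift μ, ν⟩)) * exp (-((Complex.I * (η : ℂ)) • A ⟨x.unshift ν, μ⟩))) + (2 : ℂ)⁻¹ * Matrix.trace (((Complex.I * (η : ℂ)) • A ⟨x.unshift ν, ν⟩) + (((Complex.I * (η : ℂ)) • A ⟨x, μ⟩) + t • ((Complex.I * (η : ℂ)) • E)) + (-((Complex.I * (η : ℂ)) • A ⟨(x.unshift ν).shift μ, ν⟩)) + (-((Complex.I * (η : ℂ)) • A ⟨x.unshift ν, μ⟩))) + (4 : ℂ)⁻¹ * Matrix.trace ((((Complex.I * (η : ℂ)) • A ⟨x.unshift ν, ν⟩) + (((Complex.I * (η : ℂ)) • A ⟨x, μ⟩) + t • ((Complex.I * (η : ℂ)) • E)) + (-((Complex.I * (η : ℂ)) • A ⟨(x.unshift ν).shift μ, ν⟩)) + (-((Complex.I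 * (η : ℂ)) • A ⟨x.unshift ν, μ⟩))) ^ 2)) := by
    funext t
    simp only [Site.shift_unshift, Pi.single_eq_same, Pi.single_apply, if_neg m1, if_neg m3, if_neg m4, smul_zero, neg_zero, add_zero]
  have F4 : (fun t : ℂ => (1 - (2 : ℂ)⁻¹ * Matrix.trace (exp (((Complex.I * (η : ℂ)) • A ⟨(⟨x, ν, μ, h⟩ : Plaq P j).src, (⟨x, ν, μ, h⟩ : Plaq P j).μ⟩) + t • ((Complex.I * (η : ℂ)) • (Pi.single (⟨x, μ⟩ : PBond P j) E : PBond P j → Matrix (Fin 2) (Fin 2) ℂ) ⟨(⟨x, ν, μ, h⟩ : Plaq P j).src, (⟨x, ν, μ, h⟩ : Plaq P j).μ⟩)) * exp (((Complex.I * (η : ℂ)) • A ⟨(⟨x, ν, μ, h⟩ : Plaq P j).src.shift (⟨x, ν, μ, h⟩ : Plaq P j).μ, (⟨x, ν, μ, h⟩ : Plaq P j).ν⟩) + t • ((Complex.I * (η : ℂ)) • (Pi.single (⟨x, μ⟩ : PBond P j) E : PBond P j → Matrix (Fin 2) (Fin 2) ℂ) ⟨(⟨x, ν, μ, h⟩ :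 Plaq P j).src.shift (⟨x, ν, μ, h⟩ : Plaq P j).μ, (⟨x, ν, μ, h⟩ : Plaq P j).ν⟩)) * exp ((-((Complex.I * (η : ℂ)) • A ⟨(⟨x, ν, μ, h⟩ : Plaq P j).src.shift (⟨x, ν, μ, h⟩ : Plaq P j).ν, (⟨x, ν, μ, h⟩ : Plaq P j).μ⟩)) + t • (-((Complex.I * (η : ℂ)) • (Pi.single (⟨x, μ⟩ : PBond P j) E : PBond P j → Matrix (Fin 2) (Fin 2) ℂ) ⟨(⟨x, ν, μ, h⟩ : Plaq P j).src.shift (⟨x, ν, μ, h⟩ : Plaq P j).ν, (⟨x, ν, μ, h⟩ : Plaq P j).μ⟩))) * exp ((-((Complex.I * (η : ℂ)) • A ⟨(⟨x, ν, μ, h⟩ : Plaq P j).src, (⟨x, ν, μ, h⟩ : Plaq P j).ν⟩)) + t • (-((Complex.I * (η : ℂ)) • (Pi.single (⟨x, μ⟩ : PBond P j) E : PBond P j → Matrix (Fin 2) (Fin 2) ℂ) ⟨(⟨x, ν, μ, h⟩ : Plaq P j).src, (⟨x, ν, μ, h⟩ : Plaq P j).ν⟩)))) + (2 : ℂ)⁻¹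 * Matrix.trace ((((Complex.I * (η : ℂ)) • A ⟨(⟨x, ν, μ, h⟩ : Plaq P j).src, (⟨x, ν, μ, h⟩ : Plaq P j).μ⟩) + t • ((Complex.I * (η : ℂ)) • (Pi.single (⟨x, μ⟩ : PBond P j) E : PBond P j → Matrix (Fin 2) (Fin 2) ℂ) ⟨(⟨x, ν, μ, h⟩ : Plaq P j).src, (⟨x, ν, μ, h⟩ : Plaq P j).μ⟩)) + (((Complex.I * (η : ℂ)) • A ⟨(⟨x, ν, μ, h⟩ : Plaq P j).src.shift (⟨x, ν, μ, h⟩ : Plaq P j).μ, (⟨x, ν, μ, h⟩ : Plaq P j).ν⟩) + t • ((Complex.I * (η : ℂ)) • (Pi.single (⟨x, μ⟩ : PBond P j) E : PBond P j → Matrix (Fin 2) (Fin 2) ℂ) ⟨(⟨x, ν, μ, h⟩ : Plaq P j).src.shift (⟨x, ν, μ, h⟩ : Plaq P j).μ, (⟨x, ν, μ, h⟩ : Plaq P j).ν⟩)) + ((-((Complex.I * (η : ℂ)) • A ⟨(⟨x, ν, μ, h⟩ : Plaq P j).src.shift (⟨x, ν, μ, h⟩ : Plaq P j).ν, (⟨x,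 ν, μ, h⟩ : Plaq P j).μ⟩)) + t • (-((Complex.I * (η : ℂ)) • (Pi.single (⟨x, μ⟩ : PBond P j) E : PBond P j → Matrix (Fin 2) (Fin 2) ℂ) ⟨(⟨x, ν, μ, h⟩ : Plaq P j).src.shift (⟨x, ν, μ, h⟩ : Plaq P j).ν, (⟨x, ν, μ, h⟩ : Plaq P j).μ⟩))) + ((-((Complex.I * (η : ℂ)) • A ⟨(⟨x, ν, μ, h⟩ : Plaq P j).src, (⟨x, ν, μ, h⟩ : Plaq P j).ν⟩)) + t • (-((Complex.I * (η : ℂ)) • (Pi.single (⟨x, μ⟩ : PBond P j) E : PBond P j → Matrix (Fin 2) (Fin 2) ℂ) ⟨(⟨x, ν, μ, h⟩ : Plaq P j).src, (⟨x, ν, μ, h⟩ : Plaq P j).ν⟩)))) + (4 : ℂ)⁻¹ * Matrix.trace (((((Complex.I * (η : ℂ)) • A ⟨(⟨x, ν, μ, h⟩ : Plaq P j).src, (⟨x, ν, μ, h⟩ : Plaq P j).μ⟩) + t • ((Complex.I * (η : ℂ)) • (Pi.single (⟨x, μ⟩ : PBond P j) E : PBond P j → Matrix (Fin 2) (Fin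 2) ℂ) ⟨(⟨x, ν, μ, h⟩ : Plaq P j).src, (⟨x, ν, μ, h⟩ : Plaq P j).μ⟩)) + (((Complex.I * (η : ℂ)) • A ⟨(⟨x, ν, μ, h⟩ : Plaq P j).src.shift (⟨x, ν, μ, h⟩ : Plaq P j).μ, (⟨x, ν, μ, h⟩ : Plaq P j).ν⟩) + t • ((Complex.I * (η : ℂ)) • (Pi.single (⟨x, μ⟩ : PBond P j) E : PBond P j → Matrix (Fin 2) (Fin 2) ℂ) ⟨(⟨x, ν, μ, h⟩ : Plaq P j).src.shift (⟨x, ν, μ, h⟩ : Plaq P j).μ, (⟨x, ν, μ, h⟩ : Plaq P j).ν⟩)) + ((-((Complex.I * (η : ℂ)) • A ⟨(⟨x, ν, μ, h⟩ : Plaq P j).src.shift (⟨x, ν, μ, h⟩ : Plaq P j).ν, (⟨x, ν, μ, h⟩ : Plaq P j).μ⟩)) + t • (-((Complex.I * (η : ℂ)) • (Pi.single (⟨x, μ⟩ : PBond P j) E : PBond P j → Matrix (Fin 2) (Fin 2) ℂ) ⟨(⟨x, ν, μ, h⟩ : Plaq P j).src.shift (⟨x, ν, μ, h⟩ : Plaq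 P j).ν, (⟨x, ν, μ, h⟩ : Plaq P j).μ⟩))) + ((-((Complex.I * (η : ℂ)) • A ⟨(⟨x, ν, μ, h⟩ : Plaq P j).src, (⟨x, ν, μ, h⟩ : Plaq P j).ν⟩)) + t • (-((Complex.I * (η : ℂ)) • (Pi.single (⟨x, μ⟩ : PBond P j) E : PBond P j → Matrix (Fin 2) (Fin 2) ℂ) ⟨(⟨x, ν, μ, h⟩ : Plaq P j).src, (⟨x, ν, μ, h⟩ : Plaq P j).ν⟩)))) ^ 2))) =
      fun t : ℂ => (1 - (2 : ℂ)⁻¹ * Matrix.trace (exp ((Complex.I * (η : ℂ)) • A ⟨x, ν⟩) * exp ((Complex.I * (η : ℂ)) • A ⟨x.shift ν, μ⟩) * exp (-((Complex.I * (η : ℂ)) • A ⟨x.shift μ, ν⟩)) * exp ((-((Complex.I * (η : ℂ)) • A ⟨x, μ⟩)) + t • (-((Complex.I * (η : ℂ)) • E)))) + (2 : ℂ)⁻¹ * Matrix.trace (((Complex.I * (η : ℂ)) • A ⟨x, ν⟩) + ((Complex.I * (η : ℂ)) • A ⟨x.shift ν, μ⟩) + (-((Complex.I * (η : ℂ)) •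 A ⟨x.shift μ, ν⟩)) + ((-((Complex.I * (η : ℂ)) • A ⟨x, μ⟩)) + t • (-((Complex.I * (η : ℂ)) • E)))) + (4 : ℂ)⁻¹ * Matrix.trace ((((Complex.I * (η : ℂ)) • A ⟨x, ν⟩) + ((Complex.I * (η : ℂ)) • A ⟨x.shift ν, μ⟩) + (-((Complex.I * (η : ℂ)) • A ⟨x.shift μ, ν⟩)) + ((-((Complex.I * (η : ℂ)) • A ⟨x, μ⟩)) + t • (-((Complex.I * (η : ℂ)) • E)))) ^ 2)) := by
    funext t
    simp only [Pi.single_eq_same, Pi.single_apply, if_neg n1, if_neg n2, if_neg n3, smul_zero, neg_zero, add_zero, smul_neg]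
  rw [F2, F4]
  have nc : ∀ X : Matrix (Fin 2) (Fin 2) ℂ, ‖(Complex.I * (η : ℂ)) • X‖ = η * ‖X‖ := norm_cI_smul hη
  have hH : ‖((Complex.I * (η : ℂ)) • E)‖ ≤ η := by rw [nc]; exact (mul_le_mul_of_nonneg_left hE hη.le).trans (by rw [mul_one])
  have hm0 : 0 ≤ η * r := by positivity
  have bY : ∀ b' : PBond P j, ‖(Complex.I * (η : ℂ)) • A b'‖ ≤ η * r := fun b' => by rw [nc]; exact mul_le_mul_of_nonneg_left (hA b') hη.le
  have bYn : ∀ b' : PBond P j, ‖-((Complex.I * (η : ℂ)) • A b')‖ ≤ η * r := fun b' => by rw [norm_neg]; exact bY b'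
  have dd : ∀ b₁ b₂ : PBond P j, ‖A b₁ - A b₂‖ ≤ η * r →
      ‖(Complex.I * (η : ℂ)) • A b₁ - (Complex.I * (η : ℂ)) • A b₂‖ ≤ η * (η * r) := fun b₁ b₂ hb => by
    rw [← smul_sub, nc]; exact mul_le_mul_of_nonneg_left hb hη.le
  have ddn : ∀ b₁ b₂ : PBond P j, ‖A b₁ - A b₂‖ ≤ η * r →
      ‖-((Complex.I * (η : ℂ)) • A b₁) - -((Complex.I * (η : ℂ)) • A b₂)‖ ≤ η * (η * r) := fun b₁ b₂ hb => by
    rw [neg_sub_neg, ← smul_sub, nc, norm_sub_rev]; exact mul_le_mul_of_nonneg_left hb hη.le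
  have dpn : ∀ b₁ b₂ : PBond P j, ‖A b₁ - A b₂‖ ≤ η * r →
      ‖(Complex.I * (η : ℂ)) • A b₁ + -((Complex.I * (η : ℂ)) • A b₂)‖ ≤ η * (η * r) := fun b₁ b₂ hb => by
    rw [← sub_eq_add_neg, ← smul_sub, nc]; exact mul_le_mul_of_nonneg_left hb hη.le
  have dnp : ∀ b₁ b₂ : PBond P j, ‖A b₂ - A b₁‖ ≤ η * r →
      ‖-((Complex.I * (η : ℂ)) • A b₁) + (Complex.I * (η : ℂ)) • A b₂‖ ≤ η * (η * r) := fun b₁ b₂ hb => by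
    rw [add_comm, ← sub_eq_add_neg, ← smul_sub, nc]; exact mul_le_mul_of_nonneg_left hb hη.le
  have e2 : ((x.unshift ν).shift μ).shift ν = x.shift μ := by rw [unshift_shift_comm, Site.shift_unshift]
  -- slotwise: Y = slots of p_{νμ}(x), Z = slots of p_{νμ}(x − e_ν)
  have d1 := dd ⟨x, ν⟩ ⟨x.unshift ν, ν⟩ (by simpa only [Site.shift_unshift] using hD' (x.unshift ν) ν ν)
  have d2 := dd ⟨x.shift ν, μ⟩ ⟨x, μ⟩ (hD' x μ ν)
  have d3 := ddn ⟨x.shift μ, ν⟩ ⟨(x.unshift ν).shift μ, ν⟩ (by simpa only [e2] using hD' ((x.unshift ν).shift μ) ν ν)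
  have d4 := ddn ⟨x, μ⟩ ⟨x.unshift ν, μ⟩ (by simpa only [Site.shift_unshift] using hD' (x.unshift ν) μ ν)
  have hS := dpn ⟨x, μ⟩ ⟨x.unshift ν, μ⟩ (by simpa only [Site.shift_unshift] using hD' (x.unshift ν) μ ν)
  have hT := dnp ⟨(x.unshift ν).shift μ, ν⟩ ⟨x.unshift ν, ν⟩ (by rw [norm_sub_rev]; exact hD' (x.unshift ν) ν μ)
  have hm1 : η * r + r * ‖((Complex.I * (η : ℂ)) • E)‖ ≤ 1 := by nlinarith
  have key := norm_deriv_pair42_le ((Complex.I * (η : ℂ)) • A ⟨x, ν⟩) ((Complex.I * (η : ℂ)) • A ⟨x.shift ν, μ⟩) (-((Complex.I * (η : ℂ)) • A ⟨x.shift μ, ν⟩)) (-((Complex.I * (η : ℂ)) • A ⟨x, μ⟩)) ((Complex.I * (η : ℂ)) • A ⟨x.unshift ν, ν⟩) ((Complex.I * (η : ℂ)) • A ⟨x, μ⟩) (-((Complex.I * (η : ℂ)) • A ⟨(x.unshift ν).shift μ, ν⟩)) (-((Complex.I * (η : ℂ)) • A ⟨x.unshift ν, μ⟩)) ((Complex.I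 * (η : ℂ)) • E) hm0
    (bY _) (bY _) (bYn _) (bYn _) (bY _) (bY _) (bYn _) (bYn _) d1 d2 d3 d4 hS hT hr hm1
  exact key.trans (pair_arith hη hη1 hr hr2 (norm_nonneg _) hH)

end Pairs

end Summit.QuantumFields.YangMills.Theorems.FlatProp4Bg1

end
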